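import Literature.Probability.FitznerVanDerHofstad2017.BetaMap

/-!
# Literature.Probability.FitznerVanDerHofstad2017.BoundMapMonotone — App. D of the NoBLE analysis is order-preserving

CITATION HEADER (PLACEMENT v2). Part of the certified REPRODUCTION of R. Fitzner, R. van der Hofstad, *Mean-field
behavior for nearest-neighbor percolation in d > 10*, EJP 22 (2017) no. 43 [FvdH17] and *Generalized approach to the
non-backtracking lace expansion*, PTRF 169 (2017) 1041–1119 [NoBLE17], Appendix D pp. 1110–1117; build `lace`, seat
lean1 (gen 3), node N28 / REFEREE R6 ("monotonicity of the bound map must be a Lean theorem over a typed map").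

What this module is.  `BetaMap.lean` (tree) transcribes the thirteen Mathematica functions of `General.nb` In[1]
(= [NoBLE17] (D.1)–(D.5), (D.13), (D.14), (D.21), (D.29), (D.32)) and their `Percolation.nb` wiring
(`nobleBetaOfInputs`, `extraOfInputs`).  Here we prove, as plain real-inequality bookkeeping, that the map
`Inputs ↦ (β's)` is ORDER-PRESERVING for the information order:

* `Inputs.Dom a b` — every upper-bound field of `a` is `≤` that of `b`, the four lower-bound fields (`muMin`,
  `piAlphaLower`, `piOneLower`, `psiZeroLower`) are `≥`, and the `μ_p`-bound `mu` (the state coordinate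
  `m = Γ₁/((2d−1)c_μ)` of the d = 10 iteration) is `≤`;
* `Inputs.Nonneg a` — the structural sign facts of a stage-1 record (upper fields `≥ 0`, `muMin < 1`), and
  `Inputs.WF d a` (extends it) — the well-formed region: additionally `0 ≤ mu < 1`, `0 ≤ muMin`, and the ratio of
  the geometric series summed in (D.21)/(D.29)/(D.32), `(2d·μ̄/(1−μ))·β_{Ξ^ι,abs}`, is `< 1` (the notebook feeds the
  raw `mub` there; this implies the TechCondition-III ratio of (D.13)/(D.14), which carries the percolation factor
  `(2d−1)/(2d)` — HOME/DIVERGENCE.md D13);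
* function level: `betaX_mono_fn` / `betaX_anti_fn` for each of the thirteen functions, over its own parameters;
* record level: `betaMu_mono, betaPi_mono, betaPsi_mono, cPhiUp_mono, betaAlphaPhi_mono, betaRPhi_mono,
  betaDelta_mono` (fields of `nobleBetaOfInputs`), `betaRF_mono, betaRpDelta_mono, betaRfDelta_mono` (components
  2, 3, 4 of `extraOfInputs`) are non-decreasing, `cPhiLow_anti` (component 0) and `afLow_anti` (`αFlow`, while it
  is positive) non-increasing, along `Dom` between well-formed records;
* the exception `ᾱ_F` (D.3, upper; component 1 of `extraOfInputs`): `(2dμ/(1−μ²))·(1 + A + μB − β̲_{ΣΠα}/(1−μ²))` is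
  NOT monotone in `μ` on all of `[0,1)` because of the subtracted `β̲_{ΣΠα}·μ/(1−μ²)²`; `betaAfUp_mono_fn` proves it
  non-decreasing for `0 ≤ μ ≤ μ' ≤ 7/10` provided `β̲_{ΣΠα}' ≤ 1/8`, via the elementary inequality
  `q(μ')−q(μ) ≤ 8·(r(μ')−r(μ))` for `q(m) = m/(1−m²)²`, `r(m) = m/(1−m²)` on `[0, 7/10]` (`key_q_le_r`), and
  `afUp_mono` is the record-level form.  For boxes of states reaching beyond `μ = 7/10` the frame uses instead the
  cap-free BOX MINORANT `betaAfUpBox`/`afUpBoxOfInputs` = `2d·((1+A)r(μ) + B·s(μ) − max(P₀,0)·q(m₂))` (`afUpBox_le`,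
  `afUpBox_mono`).  The caps `7/10`, `1/8` are the only numerals in the file; they are hypotheses of the no-go frame
  (`NoGoFrame.lean`), discharged there by the certified numerics of the num/carver seats;
* sign facts on the well-formed region needed by the frame: `one_le_cPhiUp`, `betaAlphaPhi_nonneg`, `betaRPhi_nonneg`,
  `betaRF_nonneg`, `betaRpDelta_nonneg`, `betaRfDelta_nonneg`, `betaDelta_nonneg` (and their function-level forms).

No facts, no `sorry`; every statement is [folklore]-tagged bookkeeping about the cited formulas.

[cite: FitznerVanDerHofstad2016NoBLE, App. D (D.1)–(D.32) pp. 1110–1117; FitznerVanDerHofstad2017, notebooks General.nb In[1], Percolation.nb In[1218]–[1237]]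
-/

noncomputable section

namespace Literature.Probability.FitznerVanDerHofstad2017
namespace BetaMap

/-! ## The information order and the well-formed region on `Inputs` -/

/-- The information order on the App. D input record: `a.Dom b` ("`b` carries weaker information than `a`") iff
every upper-bound field of `a` is `≤` the corresponding field of `b`, the four LOWER-bound fields (`muMin`,
`piAlphaLower`, `piOneLower`, `psiZeroLower`) are `≥`, and `mu` is `≤`.  [folklore] -/
structure Inputs.Dom (a b : Inputs) : Prop where
  mu : a.mu ≤ b.mu
  muMin : b.muMin ≤ a.muMin
  mubOverMu : a.mubOverMu ≤ b.mubOverMu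
  mub : a.mub ≤ b.mub
  xiAlphaOneMinusZeroAtZero : a.xiAlphaOneMinusZeroAtZero ≤ b.xiAlphaOneMinusZeroAtZero
  xiAlphaZeroMinusOneAtZero : a.xiAlphaZeroMinusOneAtZero ≤ b.xiAlphaZeroMinusOneAtZero
  xiAlphaOneMinusZeroAtEi : a.xiAlphaOneMinusZeroAtEi ≤ b.xiAlphaOneMinusZeroAtEi
  xiAlphaZeroMinusOneAtEi : a.xiAlphaZeroMinusOneAtEi ≤ b.xiAlphaZeroMinusOneAtEi
  xiIotaAlphaIAtEi : a.xiIotaAlphaIAtEi ≤ b.xiIotaAlphaIAtEi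
  xiIotaAlphaIIAtZero : a.xiIotaAlphaIIAtZero ≤ b.xiIotaAlphaIIAtZero
  xiIotaAlphaISumAroundEi : a.xiIotaAlphaISumAroundEi ≤ b.xiIotaAlphaISumAroundEi
  xiIotaAlphaIISumAroundZero : a.xiIotaAlphaIISumAroundZero ≤ b.xiIotaAlphaIISumAroundZero
  psiAlphaIOneMinusZeroAroundEi : a.psiAlphaIOneMinusZeroAroundEi ≤ b.psiAlphaIOneMinusZeroAroundEi
  psiAlphaIIZeroMinusOneAroundZero : a.psiAlphaIIZeroMinusOneAroundZero ≤ b.psiAlphaIIZeroMinusOneAroundZero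
  psiAlphaIZeroMinusOneAroundEi : a.psiAlphaIZeroMinusOneAroundEi ≤ b.psiAlphaIZeroMinusOneAroundEi
  psiAlphaIIOneMinusZeroAroundZero : a.psiAlphaIIOneMinusZeroAroundZero ≤ b.psiAlphaIIOneMinusZeroAroundZero
  piAlpha : a.piAlpha ≤ b.piAlpha
  piAlphaLower : b.piAlphaLower ≤ a.piAlphaLower
  piOneLower : b.piOneLower ≤ a.piOneLower
  psiZeroLower : b.psiZeroLower ≤ a.psiZeroLower
  xiAbs : a.xiAbs ≤ b.xiAbs
  xiOdd : a.xiOdd ≤ b.xiOdd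
  xiEven : a.xiEven ≤ b.xiEven
  xiEvenTail : a.xiEvenTail ≤ b.xiEvenTail
  xiOddTail : a.xiOddTail ≤ b.xiOddTail
  xiR0 : a.xiR0 ≤ b.xiR0
  xiR1 : a.xiR1 ≤ b.xiR1
  xiR0Delta : a.xiR0Delta ≤ b.xiR0Delta
  xiR1Delta : a.xiR1Delta ≤ b.xiR1Delta
  xiDeltaAbs : a.xiDeltaAbs ≤ b.xiDeltaAbs
  xiOddDelta : a.xiOddDelta ≤ b.xiOddDelta
  xiEvenDelta : a.xiEvenDelta ≤ b.xiEvenDelta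
  xiOddTailDelta : a.xiOddTailDelta ≤ b.xiOddTailDelta
  xiEvenTailDelta : a.xiEvenTailDelta ≤ b.xiEvenTailDelta
  psiRI0 : a.psiRI0 ≤ b.psiRI0
  psiRI1 : a.psiRI1 ≤ b.psiRI1
  psiRII0 : a.psiRII0 ≤ b.psiRII0
  psiRII1 : a.psiRII1 ≤ b.psiRII1
  psiRI0Delta : a.psiRI0Delta ≤ b.psiRI0Delta
  psiRI1Delta : a.psiRI1Delta ≤ b.psiRI1Delta
  psiRII0Delta : a.psiRII0Delta ≤ b.psiRII0Delta
  psiRII1Delta : a.psiRII1Delta ≤ b.psiRII1Delta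
  piR0 : a.piR0 ≤ b.piR0
  piR0DeltaEiEk : a.piR0DeltaEiEk ≤ b.piR0DeltaEiEk
  xiIotaAbs : a.xiIotaAbs ≤ b.xiIotaAbs
  xiIotaOdd : a.xiIotaOdd ≤ b.xiIotaOdd
  xiIotaEven : a.xiIotaEven ≤ b.xiIotaEven
  xiIotaEvenTail : a.xiIotaEvenTail ≤ b.xiIotaEvenTail
  xiIotaRI0 : a.xiIotaRI0 ≤ b.xiIotaRI0
  xiIotaRII0 : a.xiIotaRII0 ≤ b.xiIotaRII0
  xiIotaDeltaEi : a.xiIotaDeltaEi ≤ b.xiIotaDeltaEi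
  xiIotaOddDeltaEi : a.xiIotaOddDeltaEi ≤ b.xiIotaOddDeltaEi
  xiIotaEvenDeltaEi : a.xiIotaEvenDeltaEi ≤ b.xiIotaEvenDeltaEi
  xiIotaEvenTailDeltaEi : a.xiIotaEvenTailDeltaEi ≤ b.xiIotaEvenTailDeltaEi
  xiIotaDeltaZero : a.xiIotaDeltaZero ≤ b.xiIotaDeltaZero
  xiIotaOddDeltaZero : a.xiIotaOddDeltaZero ≤ b.xiIotaOddDeltaZero
  xiIotaEvenDeltaZero : a.xiIotaEvenDeltaZero ≤ b.xiIotaEvenDeltaZero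
  xiIotaEvenTailDeltaZero : a.xiIotaEvenTailDeltaZero ≤ b.xiIotaEvenTailDeltaZero
  xiIotaRI0DeltaEi : a.xiIotaRI0DeltaEi ≤ b.xiIotaRI0DeltaEi
  xiIotaRII0DeltaZero : a.xiIotaRII0DeltaZero ≤ b.xiIotaRII0DeltaZero

/-- The STRUCTURAL sign facts of a stage-1 output record: every upper-bound field is `≥ 0` (each bounds a
non-negative lattice sum) and the lower bound `muMin` on `μ_p` is `< 1` (it is `z_I·(1 − …) ≤ z_I < 1`).  These hold at
EVERY state; no sign is imposed on `piAlphaLower`, `piOneLower`, `psiZeroLower`, and nothing is said about `mu`.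
[folklore] -/
structure Inputs.Nonneg (a : Inputs) : Prop where
  muMin_lt_one : a.muMin < 1
  mubOverMu : 0 ≤ a.mubOverMu
  mub : 0 ≤ a.mub
  xiAlphaOneMinusZeroAtZero : 0 ≤ a.xiAlphaOneMinusZeroAtZero
  xiAlphaZeroMinusOneAtZero : 0 ≤ a.xiAlphaZeroMinusOneAtZero
  xiAlphaOneMinusZeroAtEi : 0 ≤ a.xiAlphaOneMinusZeroAtEi
  xiAlphaZeroMinusOneAtEi : 0 ≤ a.xiAlphaZeroMinusOneAtEi
  xiIotaAlphaIAtEi : 0 ≤ a.xiIotaAlphaIAtEi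
  xiIotaAlphaIIAtZero : 0 ≤ a.xiIotaAlphaIIAtZero
  xiIotaAlphaISumAroundEi : 0 ≤ a.xiIotaAlphaISumAroundEi
  xiIotaAlphaIISumAroundZero : 0 ≤ a.xiIotaAlphaIISumAroundZero
  psiAlphaIOneMinusZeroAroundEi : 0 ≤ a.psiAlphaIOneMinusZeroAroundEi
  psiAlphaIIZeroMinusOneAroundZero : 0 ≤ a.psiAlphaIIZeroMinusOneAroundZero
  psiAlphaIZeroMinusOneAroundEi : 0 ≤ a.psiAlphaIZeroMinusOneAroundEi
  psiAlphaIIOneMinusZeroAroundZero : 0 ≤ a.psiAlphaIIOneMinusZeroAroundZero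
  piAlpha : 0 ≤ a.piAlpha
  xiAbs : 0 ≤ a.xiAbs
  xiOdd : 0 ≤ a.xiOdd
  xiEven : 0 ≤ a.xiEven
  xiEvenTail : 0 ≤ a.xiEvenTail
  xiOddTail : 0 ≤ a.xiOddTail
  xiR0 : 0 ≤ a.xiR0
  xiR1 : 0 ≤ a.xiR1
  xiR0Delta : 0 ≤ a.xiR0Delta
  xiR1Delta : 0 ≤ a.xiR1Delta
  xiDeltaAbs : 0 ≤ a.xiDeltaAbs
  xiOddDelta : 0 ≤ a.xiOddDelta
  xiEvenDelta : 0 ≤ a.xiEvenDelta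
  xiOddTailDelta : 0 ≤ a.xiOddTailDelta
  xiEvenTailDelta : 0 ≤ a.xiEvenTailDelta
  psiRI0 : 0 ≤ a.psiRI0
  psiRI1 : 0 ≤ a.psiRI1
  psiRII0 : 0 ≤ a.psiRII0
  psiRII1 : 0 ≤ a.psiRII1
  psiRI0Delta : 0 ≤ a.psiRI0Delta
  psiRI1Delta : 0 ≤ a.psiRI1Delta
  psiRII0Delta : 0 ≤ a.psiRII0Delta
  psiRII1Delta : 0 ≤ a.psiRII1Delta
  piR0 : 0 ≤ a.piR0
  piR0DeltaEiEk : 0 ≤ a.piR0DeltaEiEk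
  xiIotaAbs : 0 ≤ a.xiIotaAbs
  xiIotaOdd : 0 ≤ a.xiIotaOdd
  xiIotaEven : 0 ≤ a.xiIotaEven
  xiIotaEvenTail : 0 ≤ a.xiIotaEvenTail
  xiIotaRI0 : 0 ≤ a.xiIotaRI0
  xiIotaRII0 : 0 ≤ a.xiIotaRII0
  xiIotaDeltaEi : 0 ≤ a.xiIotaDeltaEi
  xiIotaOddDeltaEi : 0 ≤ a.xiIotaOddDeltaEi
  xiIotaEvenDeltaEi : 0 ≤ a.xiIotaEvenDeltaEi
  xiIotaEvenTailDeltaEi : 0 ≤ a.xiIotaEvenTailDeltaEi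
  xiIotaDeltaZero : 0 ≤ a.xiIotaDeltaZero
  xiIotaOddDeltaZero : 0 ≤ a.xiIotaOddDeltaZero
  xiIotaEvenDeltaZero : 0 ≤ a.xiIotaEvenDeltaZero
  xiIotaEvenTailDeltaZero : 0 ≤ a.xiIotaEvenTailDeltaZero
  xiIotaRI0DeltaEi : 0 ≤ a.xiIotaRI0DeltaEi
  xiIotaRII0DeltaZero : 0 ≤ a.xiIotaRII0DeltaZero

/-- The well-formed region of the input record at (real) dimension parameter `d`: the structural sign facts plus the
STATE-DEPENDENT standing hypotheses of App. D — `0 ≤ mu < 1`, `0 ≤ muMin`, and `tmp2 := (2d·mub/(1−mu))·xiIotaAbs < 1`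
(ratio of the geometric series in (D.21), (D.29), (D.32) as wired by `Percolation.nb`; it implies the TechCondition-III
ratio of (D.13)/(D.14)).  [folklore] -/
structure Inputs.WF (d : ℝ) (a : Inputs) : Prop extends Inputs.Nonneg a where
  mu_nonneg : 0 ≤ a.mu
  mu_lt_one : a.mu < 1
  muMin_nonneg : 0 ≤ a.muMin
  tmp2_lt_one : 2 * d * a.mub / (1 - a.mu) * a.xiIotaAbs < 1

/-- `Inputs.Dom` is reflexive. [folklore] -/
theorem Inputs.Dom.refl (a : Inputs) : a.Dom a where
  mu := le_rfl
  muMin := le_rfl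
  mubOverMu := le_rfl
  mub := le_rfl
  xiAlphaOneMinusZeroAtZero := le_rfl
  xiAlphaZeroMinusOneAtZero := le_rfl
  xiAlphaOneMinusZeroAtEi := le_rfl
  xiAlphaZeroMinusOneAtEi := le_rfl
  xiIotaAlphaIAtEi := le_rfl
  xiIotaAlphaIIAtZero := le_rfl
  xiIotaAlphaISumAroundEi := le_rfl
  xiIotaAlphaIISumAroundZero := le_rfl
  psiAlphaIOneMinusZeroAroundEi := le_rfl
  psiAlphaIIZeroMinusOneAroundZero := le_rfl
  psiAlphaIZeroMinusOneAroundEi := le_rfl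
  psiAlphaIIOneMinusZeroAroundZero := le_rfl
  piAlpha := le_rfl
  piAlphaLower := le_rfl
  piOneLower := le_rfl
  psiZeroLower := le_rfl
  xiAbs := le_rfl
  xiOdd := le_rfl
  xiEven := le_rfl
  xiEvenTail := le_rfl
  xiOddTail := le_rfl
  xiR0 := le_rfl
  xiR1 := le_rfl
  xiR0Delta := le_rfl
  xiR1Delta := le_rfl
  xiDeltaAbs := le_rfl
  xiOddDelta := le_rfl
  xiEvenDelta := le_rfl
  xiOddTailDelta := le_rfl
  xiEvenTailDelta := le_rfl
  psiRI0 := le_rfl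
  psiRI1 := le_rfl
  psiRII0 := le_rfl
  psiRII1 := le_rfl
  psiRI0Delta := le_rfl
  psiRI1Delta := le_rfl
  psiRII0Delta := le_rfl
  psiRII1Delta := le_rfl
  piR0 := le_rfl
  piR0DeltaEiEk := le_rfl
  xiIotaAbs := le_rfl
  xiIotaOdd := le_rfl
  xiIotaEven := le_rfl
  xiIotaEvenTail := le_rfl
  xiIotaRI0 := le_rfl
  xiIotaRII0 := le_rfl
  xiIotaDeltaEi := le_rfl
  xiIotaOddDeltaEi := le_rfl
  xiIotaEvenDeltaEi := le_rfl
  xiIotaEvenTailDeltaEi := le_rfl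
  xiIotaDeltaZero := le_rfl
  xiIotaOddDeltaZero := le_rfl
  xiIotaEvenDeltaZero := le_rfl
  xiIotaEvenTailDeltaZero := le_rfl
  xiIotaRI0DeltaEi := le_rfl
  xiIotaRII0DeltaZero := le_rfl

/-- `Inputs.Dom` is transitive. [folklore] -/
theorem Inputs.Dom.trans {a b c : Inputs} (h₁ : a.Dom b) (h₂ : b.Dom c) : a.Dom c where
  mu := h₁.mu.trans h₂.mu
  muMin := h₂.muMin.trans h₁.muMin
  mubOverMu := h₁.mubOverMu.trans h₂.mubOverMu
  mub := h₁.mub.trans h₂.mub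
  xiAlphaOneMinusZeroAtZero := h₁.xiAlphaOneMinusZeroAtZero.trans h₂.xiAlphaOneMinusZeroAtZero
  xiAlphaZeroMinusOneAtZero := h₁.xiAlphaZeroMinusOneAtZero.trans h₂.xiAlphaZeroMinusOneAtZero
  xiAlphaOneMinusZeroAtEi := h₁.xiAlphaOneMinusZeroAtEi.trans h₂.xiAlphaOneMinusZeroAtEi
  xiAlphaZeroMinusOneAtEi := h₁.xiAlphaZeroMinusOneAtEi.trans h₂.xiAlphaZeroMinusOneAtEi
  xiIotaAlphaIAtEi := h₁.xiIotaAlphaIAtEi.trans h₂.xiIotaAlphaIAtEi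
  xiIotaAlphaIIAtZero := h₁.xiIotaAlphaIIAtZero.trans h₂.xiIotaAlphaIIAtZero
  xiIotaAlphaISumAroundEi := h₁.xiIotaAlphaISumAroundEi.trans h₂.xiIotaAlphaISumAroundEi
  xiIotaAlphaIISumAroundZero := h₁.xiIotaAlphaIISumAroundZero.trans h₂.xiIotaAlphaIISumAroundZero
  psiAlphaIOneMinusZeroAroundEi := h₁.psiAlphaIOneMinusZeroAroundEi.trans h₂.psiAlphaIOneMinusZeroAroundEi
  psiAlphaIIZeroMinusOneAroundZero := h₁.psiAlphaIIZeroMinusOneAroundZero.trans h₂.psiAlphaIIZeroMinusOneAroundZero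
  psiAlphaIZeroMinusOneAroundEi := h₁.psiAlphaIZeroMinusOneAroundEi.trans h₂.psiAlphaIZeroMinusOneAroundEi
  psiAlphaIIOneMinusZeroAroundZero := h₁.psiAlphaIIOneMinusZeroAroundZero.trans h₂.psiAlphaIIOneMinusZeroAroundZero
  piAlpha := h₁.piAlpha.trans h₂.piAlpha
  piAlphaLower := h₂.piAlphaLower.trans h₁.piAlphaLower
  piOneLower := h₂.piOneLower.trans h₁.piOneLower
  psiZeroLower := h₂.psiZeroLower.trans h₁.psiZeroLower
  xiAbs := h₁.xiAbs.trans h₂.xiAbs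
  xiOdd := h₁.xiOdd.trans h₂.xiOdd
  xiEven := h₁.xiEven.trans h₂.xiEven
  xiEvenTail := h₁.xiEvenTail.trans h₂.xiEvenTail
  xiOddTail := h₁.xiOddTail.trans h₂.xiOddTail
  xiR0 := h₁.xiR0.trans h₂.xiR0
  xiR1 := h₁.xiR1.trans h₂.xiR1
  xiR0Delta := h₁.xiR0Delta.trans h₂.xiR0Delta
  xiR1Delta := h₁.xiR1Delta.trans h₂.xiR1Delta
  xiDeltaAbs := h₁.xiDeltaAbs.trans h₂.xiDeltaAbs
  xiOddDelta := h₁.xiOddDelta.trans h₂.xiOddDelta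
  xiEvenDelta := h₁.xiEvenDelta.trans h₂.xiEvenDelta
  xiOddTailDelta := h₁.xiOddTailDelta.trans h₂.xiOddTailDelta
  xiEvenTailDelta := h₁.xiEvenTailDelta.trans h₂.xiEvenTailDelta
  psiRI0 := h₁.psiRI0.trans h₂.psiRI0
  psiRI1 := h₁.psiRI1.trans h₂.psiRI1
  psiRII0 := h₁.psiRII0.trans h₂.psiRII0
  psiRII1 := h₁.psiRII1.trans h₂.psiRII1
  psiRI0Delta := h₁.psiRI0Delta.trans h₂.psiRI0Delta
  psiRI1Delta := h₁.psiRI1Delta.trans h₂.psiRI1Delta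
  psiRII0Delta := h₁.psiRII0Delta.trans h₂.psiRII0Delta
  psiRII1Delta := h₁.psiRII1Delta.trans h₂.psiRII1Delta
  piR0 := h₁.piR0.trans h₂.piR0
  piR0DeltaEiEk := h₁.piR0DeltaEiEk.trans h₂.piR0DeltaEiEk
  xiIotaAbs := h₁.xiIotaAbs.trans h₂.xiIotaAbs
  xiIotaOdd := h₁.xiIotaOdd.trans h₂.xiIotaOdd
  xiIotaEven := h₁.xiIotaEven.trans h₂.xiIotaEven
  xiIotaEvenTail := h₁.xiIotaEvenTail.trans h₂.xiIotaEvenTail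
  xiIotaRI0 := h₁.xiIotaRI0.trans h₂.xiIotaRI0
  xiIotaRII0 := h₁.xiIotaRII0.trans h₂.xiIotaRII0
  xiIotaDeltaEi := h₁.xiIotaDeltaEi.trans h₂.xiIotaDeltaEi
  xiIotaOddDeltaEi := h₁.xiIotaOddDeltaEi.trans h₂.xiIotaOddDeltaEi
  xiIotaEvenDeltaEi := h₁.xiIotaEvenDeltaEi.trans h₂.xiIotaEvenDeltaEi
  xiIotaEvenTailDeltaEi := h₁.xiIotaEvenTailDeltaEi.trans h₂.xiIotaEvenTailDeltaEi
  xiIotaDeltaZero := h₁.xiIotaDeltaZero.trans h₂.xiIotaDeltaZero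
  xiIotaOddDeltaZero := h₁.xiIotaOddDeltaZero.trans h₂.xiIotaOddDeltaZero
  xiIotaEvenDeltaZero := h₁.xiIotaEvenDeltaZero.trans h₂.xiIotaEvenDeltaZero
  xiIotaEvenTailDeltaZero := h₁.xiIotaEvenTailDeltaZero.trans h₂.xiIotaEvenTailDeltaZero
  xiIotaRI0DeltaEi := h₁.xiIotaRI0DeltaEi.trans h₂.xiIotaRI0DeltaEi
  xiIotaRII0DeltaZero := h₁.xiIotaRII0DeltaZero.trans h₂.xiIotaRII0DeltaZero

/-- Derived facts on the well-formed region (used by the record-level corollaries). [folklore] -/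
structure Inputs.Facts (d : ℝ) (a : Inputs) : Prop where
  d_pos : 0 < d
  perc_nonneg : 0 ≤ (2 * d - 1) / (2 * d)
  tmp1_lt_one : 2 * d * ((2 * d - 1) / (2 * d) * a.mub) / (1 - a.mu) * a.xiIotaAbs < 1

/-- The well-formed region supplies the derived facts (for `1 ≤ d`). [folklore] -/
theorem Inputs.WF.facts {d : ℝ} {a : Inputs} (hd : 1 ≤ d) (ha : a.WF d) : a.Facts d := by
  have hd0 : 0 < d := by linarith
  have h2d : 0 < 2 * d := by linarith
  have hperc : 0 ≤ (2 * d - 1) / (2 * d) := div_nonneg (by linarith) h2d.le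
  have hperc1 : (2 * d - 1) / (2 * d) ≤ 1 := by rw [div_le_one h2d]; linarith
  have hmu1 := ha.mu_lt_one
  have h1 : 0 < 1 - a.mu := by linarith
  have hmub := ha.mub; have hxi := ha.xiIotaAbs
  have hle : 2 * d * ((2 * d - 1) / (2 * d) * a.mub) / (1 - a.mu) * a.xiIotaAbs
      ≤ 2 * d * a.mub / (1 - a.mu) * a.xiIotaAbs := by
    have : (2 * d - 1) / (2 * d) * a.mub ≤ a.mub := by
      calc (2 * d - 1) / (2 * d) * a.mub ≤ 1 * a.mub := by gcongr
        _ = a.mub := one_mul _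
    gcongr
  exact ⟨hd0, hperc, lt_of_le_of_lt hle ha.tmp2_lt_one⟩

/-! ## Function-level monotonicity (one lemma per `General.nb` function) -/

section Fn

/-- `0 ≤ x < 1 → 0 < 1 − x²`. [folklore] -/
theorem one_sub_sq_pos {x : ℝ} (h0 : 0 ≤ x) (h1 : x < 1) : 0 < 1 - x ^ 2 := by nlinarith

/-- (D.1): `betaMubarOverMu` is non-decreasing in the information order on its arguments. [folklore] -/
theorem betaMubarOverMu_mono_fn {d MuOverMu MuOverMu' : ℝ}
    (h1 : MuOverMu ≤ MuOverMu') (g1 : 0 ≤ MuOverMu) :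
    betaMubarOverMu d MuOverMu ≤ betaMubarOverMu d MuOverMu' := by
  have g1' : 0 ≤ MuOverMu' := g1.trans h1
  simp only [betaMubarOverMu]
  gcongr

/-- (D.2), lower: `betaCPhiLow` is non-INCREASING in the information order on its arguments. [folklore] -/
theorem betaCPhiLow_anti_fn {d mu XiOneminusZeroAtZero XiIotaAlphaI mu' XiOneminusZeroAtZero' XiIotaAlphaI' : ℝ}
    (hd : 0 < d) (hmu0 : 0 ≤ mu) (hmu : mu ≤ mu') (hmu1 : mu' < 1) (h1 : XiOneminusZeroAtZero ≤ XiOneminusZeroAtZero') (h2 : XiIotaAlphaI ≤ XiIotaAlphaI') (g1 : 0 ≤ XiOneminusZeroAtZero) (g2 : 0 ≤ XiIotaAlphaI) :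
    betaCPhiLow d mu' XiOneminusZeroAtZero' XiIotaAlphaI' ≤ betaCPhiLow d mu XiOneminusZeroAtZero XiIotaAlphaI := by
  have g1' : 0 ≤ XiOneminusZeroAtZero' := g1.trans h1
  have g2' : 0 ≤ XiIotaAlphaI' := g2.trans h2
  have hmu0' : 0 ≤ mu' := hmu0.trans hmu
  have e1 : 0 < 1 - mu := sub_pos.2 (lt_of_le_of_lt hmu hmu1)
  have e1' : 0 < 1 - mu' := sub_pos.2 hmu1
  have e2 : 0 < 1 - mu ^ 2 := one_sub_sq_pos hmu0 (lt_of_le_of_lt hmu hmu1)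
  have e2' : 0 < 1 - mu' ^ 2 := one_sub_sq_pos hmu0' hmu1
  have e3 : 0 < 1 + mu := by positivity
  have e3' : 0 < 1 + mu' := by positivity
  simp only [betaCPhiLow]
  gcongr

/-- (D.2), upper: `betaCPhiUp` is non-decreasing in the information order on its arguments. [folklore] -/
theorem betaCPhiUp_mono_fn {d mu XiZerominusOneAtZero XiIotaAlphaII mu' XiZerominusOneAtZero' XiIotaAlphaII' : ℝ}
    (hd : 0 < d) (hmu0 : 0 ≤ mu) (hmu : mu ≤ mu') (hmu1 : mu' < 1) (h1 : XiZerominusOneAtZero ≤ XiZerominusOneAtZero') (h2 : XiIotaAlphaII ≤ XiIotaAlphaII') (g1 : 0 ≤ XiZerominusOneAtZero) (g2 : 0 ≤ XiIotaAlphaII) :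
    betaCPhiUp d mu XiZerominusOneAtZero XiIotaAlphaII ≤ betaCPhiUp d mu' XiZerominusOneAtZero' XiIotaAlphaII' := by
  have g1' : 0 ≤ XiZerominusOneAtZero' := g1.trans h1
  have g2' : 0 ≤ XiIotaAlphaII' := g2.trans h2
  have hmu0' : 0 ≤ mu' := hmu0.trans hmu
  have e1 : 0 < 1 - mu := sub_pos.2 (lt_of_le_of_lt hmu hmu1)
  have e1' : 0 < 1 - mu' := sub_pos.2 hmu1
  have e2 : 0 < 1 - mu ^ 2 := one_sub_sq_pos hmu0 (lt_of_le_of_lt hmu hmu1)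
  have e2' : 0 < 1 - mu' ^ 2 := one_sub_sq_pos hmu0' hmu1
  have e3 : 0 < 1 + mu := by positivity
  have e3' : 0 < 1 + mu' := by positivity
  simp only [betaCPhiUp]
  gcongr

/-- (D.3), lower: `betaAfLow` is non-INCREASING in the information order on its arguments as long as its value at the larger argument is still positive. [folklore] -/
theorem betaAfLow_anti_fn {d muMIN mu PsiOneminusZeroAlphaI PsiZerominusOneAlphaII PiSumAlpha muMIN' mu' PsiOneminusZeroAlphaI' PsiZerominusOneAlphaII' PiSumAlpha' : ℝ}
    (hd : 0 < d) (hmu0 : 0 ≤ mu) (hmu : mu ≤ mu') (hmu1 : mu' < 1) (h1 : muMIN' ≤ muMIN) (h2 : PsiOneminusZeroAlphaI ≤ PsiOneminusZeroAlphaI') (h3 : PsiZerominusOneAlphaII ≤ PsiZerominusOneAlphaII') (h4 : PiSumAlpha ≤ PiSumAlpha') (g1 : 0 ≤ muMIN') (g1l : muMIN < 1) (g2 : 0 ≤ PsiOneminusZeroAlphaI) (g3 : 0 ≤ PsiZerominusOneAlphaII) (g4 : 0 ≤ PiSumAlpha) (hpos : 0 < betaAfLow d muMIN' mu' PsiOneminusZeroAlphaI'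 PsiZerominusOneAlphaII' PiSumAlpha') :
    betaAfLow d muMIN' mu' PsiOneminusZeroAlphaI' PsiZerominusOneAlphaII' PiSumAlpha' ≤ betaAfLow d muMIN mu PsiOneminusZeroAlphaI PsiZerominusOneAlphaII PiSumAlpha := by
  have g2' : 0 ≤ PsiOneminusZeroAlphaI' := g2.trans h2
  have g3' : 0 ≤ PsiZerominusOneAlphaII' := g3.trans h3
  have g4' : 0 ≤ PiSumAlpha' := g4.trans h4
  have hmu0' : 0 ≤ mu' := hmu0.trans hmu
  have e1 : 0 < 1 - mu := sub_pos.2 (lt_of_le_of_lt hmu hmu1)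
  have e1' : 0 < 1 - mu' := sub_pos.2 hmu1
  have e2 : 0 < 1 - mu ^ 2 := one_sub_sq_pos hmu0 (lt_of_le_of_lt hmu hmu1)
  have e2' : 0 < 1 - mu' ^ 2 := one_sub_sq_pos hmu0' hmu1
  have e3 : 0 < 1 + mu := by positivity
  have e3' : 0 < 1 + mu' := by positivity
  have gm : 0 ≤ muMIN := g1.trans h1
  have em : 0 < 1 - muMIN ^ 2 := one_sub_sq_pos gm g1l
  have em' : 0 < 1 - muMIN' ^ 2 := one_sub_sq_pos g1 (lt_of_le_of_lt h1 g1l)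
  simp only [betaAfLow] at hpos ⊢
  have hg : 0 ≤ 2 * d * muMIN' / (1 - muMIN' ^ 2) := by positivity
  have hbr : 0 < 1 - PsiOneminusZeroAlphaI' - mu' * PsiZerominusOneAlphaII' - 1 / (1 - mu' ^ 2) * PiSumAlpha' := by
    by_contra hc
    have := mul_nonpos_of_nonneg_of_nonpos hg (not_lt.mp hc)
    linarith
  gcongr

/-- (D.4), member I: `betaapI` is non-decreasing in the information order on its arguments. [folklore] -/
theorem betaapI_mono_fn {d mu XiOneminusZeroAlphaIei XiIotaAlphaIsumei mu' XiOneminusZeroAlphaIei' XiIotaAlphaIsumei' : ℝ}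
    (hd : 0 < d) (hmu0 : 0 ≤ mu) (hmu : mu ≤ mu') (hmu1 : mu' < 1) (h1 : XiOneminusZeroAlphaIei ≤ XiOneminusZeroAlphaIei') (h2 : XiIotaAlphaIsumei ≤ XiIotaAlphaIsumei') (g1 : 0 ≤ XiOneminusZeroAlphaIei) (g2 : 0 ≤ XiIotaAlphaIsumei) :
    betaapI d mu XiOneminusZeroAlphaIei XiIotaAlphaIsumei ≤ betaapI d mu' XiOneminusZeroAlphaIei' XiIotaAlphaIsumei' := by
  have g1' : 0 ≤ XiOneminusZeroAlphaIei' := g1.trans h1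
  have g2' : 0 ≤ XiIotaAlphaIsumei' := g2.trans h2
  have hmu0' : 0 ≤ mu' := hmu0.trans hmu
  have e1 : 0 < 1 - mu := sub_pos.2 (lt_of_le_of_lt hmu hmu1)
  have e1' : 0 < 1 - mu' := sub_pos.2 hmu1
  have e2 : 0 < 1 - mu ^ 2 := one_sub_sq_pos hmu0 (lt_of_le_of_lt hmu hmu1)
  have e2' : 0 < 1 - mu' ^ 2 := one_sub_sq_pos hmu0' hmu1
  have e3 : 0 < 1 + mu := by positivity
  have e3' : 0 < 1 + mu' := by positivity
  simp only [betaapI]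
  gcongr

/-- (D.4), member II: `betaapII` is non-decreasing in the information order on its arguments. [folklore] -/
theorem betaapII_mono_fn {d mu XiZerominusOneAlphaIei XiIotaAlphaIIsumzero mu' XiZerominusOneAlphaIei' XiIotaAlphaIIsumzero' : ℝ}
    (hd : 0 < d) (hmu0 : 0 ≤ mu) (hmu : mu ≤ mu') (hmu1 : mu' < 1) (h1 : XiZerominusOneAlphaIei ≤ XiZerominusOneAlphaIei') (h2 : XiIotaAlphaIIsumzero ≤ XiIotaAlphaIIsumzero') (g1 : 0 ≤ XiZerominusOneAlphaIei) (g2 : 0 ≤ XiIotaAlphaIIsumzero) :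
    betaapII d mu XiZerominusOneAlphaIei XiIotaAlphaIIsumzero ≤ betaapII d mu' XiZerominusOneAlphaIei' XiIotaAlphaIIsumzero' := by
  have g1' : 0 ≤ XiZerominusOneAlphaIei' := g1.trans h1
  have g2' : 0 ≤ XiIotaAlphaIIsumzero' := g2.trans h2
  have hmu0' : 0 ≤ mu' := hmu0.trans hmu
  have e1 : 0 < 1 - mu := sub_pos.2 (lt_of_le_of_lt hmu hmu1)
  have e1' : 0 < 1 - mu' := sub_pos.2 hmu1
  have e2 : 0 < 1 - mu ^ 2 := one_sub_sq_pos hmu0 (lt_of_le_of_lt hmu hmu1)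
  have e2' : 0 < 1 - mu' ^ 2 := one_sub_sq_pos hmu0' hmu1
  have e3 : 0 < 1 + mu := by positivity
  have e3' : 0 < 1 + mu' := by positivity
  simp only [betaapII]
  gcongr

/-- (D.5): `betaPiHat` is non-decreasing in the information order on its arguments. [folklore] -/
theorem betaPiHat_mono_fn {d muPiToXiIota XiIotaEven PiLower muPiToXiIota' XiIotaEven' PiLower' : ℝ}
    (hd : 0 < d) (h1 : muPiToXiIota ≤ muPiToXiIota') (h2 : XiIotaEven ≤ XiIotaEven') (h3 : PiLower' ≤ PiLower) (g1 : 0 ≤ muPiToXiIota) (g2 : 0 ≤ XiIotaEven) :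
    betaPiHat d muPiToXiIota XiIotaEven PiLower ≤ betaPiHat d muPiToXiIota' XiIotaEven' PiLower' := by
  have g1' : 0 ≤ muPiToXiIota' := g1.trans h1
  have g2' : 0 ≤ XiIotaEven' := g2.trans h2
  simp only [betaPiHat]
  gcongr

/-- (D.5): `betaPsiHatLower` is non-decreasing in the information order on its arguments. [folklore] -/
theorem betaPsiHatLower_mono_fn {d PsiToXi XiOdd PsiLower PsiToXi' XiOdd' PsiLower' : ℝ}
    (h1 : PsiToXi ≤ PsiToXi') (h2 : XiOdd ≤ XiOdd') (h3 : PsiLower' ≤ PsiLower) (g1 : 0 ≤ PsiToXi) (g2 : 0 ≤ XiOdd) :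
    betaPsiHatLower d PsiToXi XiOdd PsiLower ≤ betaPsiHatLower d PsiToXi' XiOdd' PsiLower' := by
  have g1' : 0 ≤ PsiToXi' := g1.trans h1
  have g2' : 0 ≤ XiOdd' := g2.trans h2
  simp only [betaPsiHatLower]
  gcongr

/-- (D.13): `betaRF` is non-decreasing in the information order on its arguments (on the region where the series ratio at the larger argument is `< 1`). [folklore] -/
theorem betaRF_mono_fn {d mu mubar PsiToXi muPiToXii XiAbs XigeqTwoAbs XiIotaAbs XiIotageqOneAbs PsiRI PsiRII PiR mu' mubar' PsiToXi' muPiToXii' XiAbs' XigeqTwoAbs' XiIotaAbs' XiIotageqOneAbs' PsiRI' PsiRII' PiR' : ℝ}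
    (hd : 0 < d) (hmu0 : 0 ≤ mu) (hmu : mu ≤ mu') (hmu1 : mu' < 1) (h1 : mubar ≤ mubar') (h2 : PsiToXi ≤ PsiToXi') (h3 : muPiToXii ≤ muPiToXii') (h4 : XiAbs ≤ XiAbs') (h5 : XigeqTwoAbs ≤ XigeqTwoAbs') (h6 : XiIotaAbs ≤ XiIotaAbs') (h7 : XiIotageqOneAbs ≤ XiIotageqOneAbs') (h8 : PsiRI ≤ PsiRI') (h9 : PsiRII ≤ PsiRII') (h10 : PiR ≤ PiR') (g1 : 0 ≤ mubar) (g2 : 0 ≤ PsiToXi) (g3 : 0 ≤ muPiToXii) (g4 : 0 ≤ XiAbs) (g5 : 0 ≤ XigeqTwoAbs) (g6 : 0 ≤ XiIotaAbs) (g7 : 0 ≤ XiIotageqOneAbs) (g8 : 0 ≤ PsiRI) (g9 : 0 ≤ PsiRII) (g10 : 0 ≤ PiR) (ht : 2 * d * muPiToXii' / (1 - mu') * XiIotaAbs' < 1) :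
    betaRF d mu mubar PsiToXi muPiToXii XiAbs XigeqTwoAbs XiIotaAbs XiIotageqOneAbs PsiRI PsiRII PiR ≤ betaRF d mu' mubar' PsiToXi' muPiToXii' XiAbs' XigeqTwoAbs' XiIotaAbs' XiIotageqOneAbs' PsiRI' PsiRII' PiR' := by
  have g1' : 0 ≤ mubar' := g1.trans h1
  have g2' : 0 ≤ PsiToXi' := g2.trans h2
  have g3' : 0 ≤ muPiToXii' := g3.trans h3
  have g4' : 0 ≤ XiAbs' := g4.trans h4
  have g5' : 0 ≤ XigeqTwoAbs' := g5.trans h5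
  have g6' : 0 ≤ XiIotaAbs' := g6.trans h6
  have g7' : 0 ≤ XiIotageqOneAbs' := g7.trans h7
  have g8' : 0 ≤ PsiRI' := g8.trans h8
  have g9' : 0 ≤ PsiRII' := g9.trans h9
  have g10' : 0 ≤ PiR' := g10.trans h10
  have hmu0' : 0 ≤ mu' := hmu0.trans hmu
  have e1 : 0 < 1 - mu := sub_pos.2 (lt_of_le_of_lt hmu hmu1)
  have e1' : 0 < 1 - mu' := sub_pos.2 hmu1
  have e2 : 0 < 1 - mu ^ 2 := one_sub_sq_pos hmu0 (lt_of_le_of_lt hmu hmu1)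
  have e2' : 0 < 1 - mu' ^ 2 := one_sub_sq_pos hmu0' hmu1
  have e3 : 0 < 1 + mu := by positivity
  have e3' : 0 < 1 + mu' := by positivity
  have t0 : 0 ≤ 2 * d * muPiToXii / (1 - mu) * XiIotaAbs := by positivity
  have t0' : 0 ≤ 2 * d * muPiToXii' / (1 - mu') * XiIotaAbs' := by positivity
  have tle : 2 * d * muPiToXii / (1 - mu) * XiIotaAbs ≤ 2 * d * muPiToXii' / (1 - mu') * XiIotaAbs' := by
    gcongr
  have f1 : 0 < 1 - 2 * d * muPiToXii / (1 - mu) * XiIotaAbs := by linarith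
  have f1' : 0 < 1 - 2 * d * muPiToXii' / (1 - mu') * XiIotaAbs' := by linarith
  have f2 : 0 ≤ 1 - 2 * d * muPiToXii / (1 - mu) * XiIotaAbs := f1.le
  have f2' : 0 ≤ 1 - 2 * d * muPiToXii' / (1 - mu') * XiIotaAbs' := f1'.le
  simp only [betaRF]
  gcongr

/-- (D.14): `betaRp` is non-decreasing in the information order on its arguments (on the region where the series ratio at the larger argument is `< 1`). [folklore] -/
theorem betaRp_mono_fn {d mu muPsiToXi muPiToXiIota XiAbs XiR XigeqTwoAbs XiIotaAbs XiIotageqOneAbs XiIotaRI XiIotaRII mu' muPsiToXi' muPiToXiIota' XiAbs' XiR' XigeqTwoAbs' XiIotaAbs' XiIotageqOneAbs' XiIotaRI' XiIotaRII' : ℝ}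
    (hd : 0 < d) (hmu0 : 0 ≤ mu) (hmu : mu ≤ mu') (hmu1 : mu' < 1) (h1 : muPsiToXi ≤ muPsiToXi') (h2 : muPiToXiIota ≤ muPiToXiIota') (h3 : XiAbs ≤ XiAbs') (h4 : XiR ≤ XiR') (h5 : XigeqTwoAbs ≤ XigeqTwoAbs') (h6 : XiIotaAbs ≤ XiIotaAbs') (h7 : XiIotageqOneAbs ≤ XiIotageqOneAbs') (h8 : XiIotaRI ≤ XiIotaRI') (h9 : XiIotaRII ≤ XiIotaRII') (g1 : 0 ≤ muPsiToXi) (g2 : 0 ≤ muPiToXiIota) (g3 : 0 ≤ XiAbs) (g4 : 0 ≤ XiR) (g5 : 0 ≤ XigeqTwoAbs) (g6 : 0 ≤ XiIotaAbs) (g7 : 0 ≤ XiIotageqOneAbs) (g8 : 0 ≤ XiIotaRI) (g9 : 0 ≤ XiIotaRII) (ht : 2 * d * muPiToXiIota' / (1 - mu') * XiIotaAbs' < 1) :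
    betaRp d mu muPsiToXi muPiToXiIota XiAbs XiR XigeqTwoAbs XiIotaAbs XiIotageqOneAbs XiIotaRI XiIotaRII ≤ betaRp d mu' muPsiToXi' muPiToXiIota' XiAbs' XiR' XigeqTwoAbs' XiIotaAbs' XiIotageqOneAbs' XiIotaRI' XiIotaRII' := by
  have g1' : 0 ≤ muPsiToXi' := g1.trans h1
  have g2' : 0 ≤ muPiToXiIota' := g2.trans h2
  have g3' : 0 ≤ XiAbs' := g3.trans h3
  have g4' : 0 ≤ XiR' := g4.trans h4
  have g5' : 0 ≤ XigeqTwoAbs' := g5.trans h5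
  have g6' : 0 ≤ XiIotaAbs' := g6.trans h6
  have g7' : 0 ≤ XiIotageqOneAbs' := g7.trans h7
  have g8' : 0 ≤ XiIotaRI' := g8.trans h8
  have g9' : 0 ≤ XiIotaRII' := g9.trans h9
  have hmu0' : 0 ≤ mu' := hmu0.trans hmu
  have e1 : 0 < 1 - mu := sub_pos.2 (lt_of_le_of_lt hmu hmu1)
  have e1' : 0 < 1 - mu' := sub_pos.2 hmu1
  have e2 : 0 < 1 - mu ^ 2 := one_sub_sq_pos hmu0 (lt_of_le_of_lt hmu hmu1)
  have e2' : 0 < 1 - mu' ^ 2 := one_sub_sq_pos hmu0' hmu1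
  have e3 : 0 < 1 + mu := by positivity
  have e3' : 0 < 1 + mu' := by positivity
  have t0 : 0 ≤ 2 * d * muPiToXiIota / (1 - mu) * XiIotaAbs := by positivity
  have t0' : 0 ≤ 2 * d * muPiToXiIota' / (1 - mu') * XiIotaAbs' := by positivity
  have tle : 2 * d * muPiToXiIota / (1 - mu) * XiIotaAbs ≤ 2 * d * muPiToXiIota' / (1 - mu') * XiIotaAbs' := by
    gcongr
  have f1 : 0 < 1 - 2 * d * muPiToXiIota / (1 - mu) * XiIotaAbs := by linarith
  have f1' : 0 < 1 - 2 * d * muPiToXiIota' / (1 - mu') * XiIotaAbs' := by linarith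
  have f2 : 0 ≤ 1 - 2 * d * muPiToXiIota / (1 - mu) * XiIotaAbs := f1.le
  have f2' : 0 ≤ 1 - 2 * d * muPiToXiIota' / (1 - mu') * XiIotaAbs' := f1'.le
  simp only [betaRp]
  gcongr

/-- (D.21): `betaRpDelta` is non-decreasing in the information order on its arguments (on the region where the series ratio at the larger argument is `< 1`). [folklore] -/
theorem betaRpDelta_mono_fn {d mu PsiToXi muPiToXii XiAbs XiDeltaAbs XiDeltaR XiDeltageqTwoAbs XiIotaAbs XiIotaDeltaEiAbs XiIotaDeltaZeroAbs XiIotaDeltaEigeqOneAbs XiIotaDeltaZerogeqOneAbs XiIotaDeltaRI XiIotaDeltaRII mu' PsiToXi' muPiToXii' XiAbs' XiDeltaAbs' XiDeltaR' XiDeltageqTwoAbs' XiIotaAbs' XiIotaDeltaEiAbs' XiIotaDeltaZeroAbs' XiIotaDeltaEigeqOneAbs' XiIotaDeltaZerogeqOneAbs' XiIotaDeltaRI' XiIotaDeltaRII' : ℝ}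
    (hd : 0 < d) (hmu0 : 0 ≤ mu) (hmu : mu ≤ mu') (hmu1 : mu' < 1) (h1 : PsiToXi ≤ PsiToXi') (h2 : muPiToXii ≤ muPiToXii') (h3 : XiAbs ≤ XiAbs') (h4 : XiDeltaAbs ≤ XiDeltaAbs') (h5 : XiDeltaR ≤ XiDeltaR') (h6 : XiDeltageqTwoAbs ≤ XiDeltageqTwoAbs') (h7 : XiIotaAbs ≤ XiIotaAbs') (h8 : XiIotaDeltaEiAbs ≤ XiIotaDeltaEiAbs') (h9 : XiIotaDeltaZeroAbs ≤ XiIotaDeltaZeroAbs') (h10 : XiIotaDeltaEigeqOneAbs ≤ XiIotaDeltaEigeqOneAbs') (h11 : XiIotaDeltaZerogeqOneAbs ≤ XiIotaDeltaZerogeqOneAbs') (h12 : XiIotaDeltaRI ≤ XiIotaDeltaRI') (h13 : XiIotaDeltaRII ≤ XiIotaDeltaRII') (g1 : 0 ≤ PsiToXi) (g2 : 0 ≤ muPiToXii) (g3 : 0 ≤ XiAbs) (g4 : 0 ≤ XiDeltaAbs) (g5 : 0 ≤ XiDeltaR) (g6 : 0 ≤ XiDeltageqTwoAbs) (g7 :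 0 ≤ XiIotaAbs) (g8 : 0 ≤ XiIotaDeltaEiAbs) (g9 : 0 ≤ XiIotaDeltaZeroAbs) (g10 : 0 ≤ XiIotaDeltaEigeqOneAbs) (g11 : 0 ≤ XiIotaDeltaZerogeqOneAbs) (g12 : 0 ≤ XiIotaDeltaRI) (g13 : 0 ≤ XiIotaDeltaRII) (ht : 2 * d * muPiToXii' / (1 - mu') * XiIotaAbs' < 1) :
    betaRpDelta d mu PsiToXi muPiToXii XiAbs XiDeltaAbs XiDeltaR XiDeltageqTwoAbs XiIotaAbs XiIotaDeltaEiAbs XiIotaDeltaZeroAbs XiIotaDeltaEigeqOneAbs XiIotaDeltaZerogeqOneAbs XiIotaDeltaRI XiIotaDeltaRII ≤ betaRpDelta d mu' PsiToXi' muPiToXii' XiAbs' XiDeltaAbs' XiDeltaR' XiDeltageqTwoAbs' XiIotaAbs' XiIotaDeltaEiAbs' XiIotaDeltaZeroAbs' XiIotaDeltaEigeqOneAbs' XiIotaDeltaZerogeqOneAbs' XiIotaDeltaRI' XiIotaDeltaRII' := by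
  have g1' : 0 ≤ PsiToXi' := g1.trans h1
  have g2' : 0 ≤ muPiToXii' := g2.trans h2
  have g3' : 0 ≤ XiAbs' := g3.trans h3
  have g4' : 0 ≤ XiDeltaAbs' := g4.trans h4
  have g5' : 0 ≤ XiDeltaR' := g5.trans h5
  have g6' : 0 ≤ XiDeltageqTwoAbs' := g6.trans h6
  have g7' : 0 ≤ XiIotaAbs' := g7.trans h7
  have g8' : 0 ≤ XiIotaDeltaEiAbs' := g8.trans h8
  have g9' : 0 ≤ XiIotaDeltaZeroAbs' := g9.trans h9
  have g10' : 0 ≤ XiIotaDeltaEigeqOneAbs' := g10.trans h10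
  have g11' : 0 ≤ XiIotaDeltaZerogeqOneAbs' := g11.trans h11
  have g12' : 0 ≤ XiIotaDeltaRI' := g12.trans h12
  have g13' : 0 ≤ XiIotaDeltaRII' := g13.trans h13
  have hmu0' : 0 ≤ mu' := hmu0.trans hmu
  have e1 : 0 < 1 - mu := sub_pos.2 (lt_of_le_of_lt hmu hmu1)
  have e1' : 0 < 1 - mu' := sub_pos.2 hmu1
  have e2 : 0 < 1 - mu ^ 2 := one_sub_sq_pos hmu0 (lt_of_le_of_lt hmu hmu1)
  have e2' : 0 < 1 - mu' ^ 2 := one_sub_sq_pos hmu0' hmu1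
  have e3 : 0 < 1 + mu := by positivity
  have e3' : 0 < 1 + mu' := by positivity
  have t0 : 0 ≤ 2 * d * muPiToXii / (1 - mu) * XiIotaAbs := by positivity
  have t0' : 0 ≤ 2 * d * muPiToXii' / (1 - mu') * XiIotaAbs' := by positivity
  have tle : 2 * d * muPiToXii / (1 - mu) * XiIotaAbs ≤ 2 * d * muPiToXii' / (1 - mu') * XiIotaAbs' := by
    gcongr
  have f1 : 0 < 1 - 2 * d * muPiToXii / (1 - mu) * XiIotaAbs := by linarith
  have f1' : 0 < 1 - 2 * d * muPiToXii' / (1 - mu') * XiIotaAbs' := by linarith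
  have f2 : 0 ≤ 1 - 2 * d * muPiToXii / (1 - mu) * XiIotaAbs := f1.le
  have f2' : 0 ≤ 1 - 2 * d * muPiToXii' / (1 - mu') * XiIotaAbs' := f1'.le
  have r0 : 0 ≤ 1 - 1 / (1 + mu) := by rw [sub_nonneg, div_le_one e3]; linarith
  have r0' : 0 ≤ 1 - 1 / (1 + mu') := by rw [sub_nonneg, div_le_one e3']; linarith
  have rw1 : ∀ (W m P X : ℝ), 0 ≤ m → W * (m + m * P * X) / (1 + m) = W * (1 + P * X) * (1 - 1 / (1 + m)) := by
    intro W m P X hm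
    have : (1 + m) ≠ 0 := by positivity
    field_simp
    ring
  simp only [betaRpDelta, rw1 _ mu _ _ hmu0, rw1 _ mu' _ _ hmu0']
  gcongr

set_option maxHeartbeats 1600000 in
/-- (D.29): `betaRfDelta` is non-decreasing in the information order on its arguments (on the region where the series ratio at the larger argument is `< 1`). [folklore] -/
theorem betaRfDelta_mono_fn {d mu PsiToXi muPiToXii XiAbs XiDeltaAbs XigeqTwoAbs XiDeltageqTwoAbs PsiRDeltaI PsiRDeltaII XiIotaAbs XiIotaDeltaEiAbs XiIotaDeltaZeroAbs XiIotageqOneAbs XiIotaDeltaEigeqOneAbs betaPiRDelta mu' PsiToXi' muPiToXii' XiAbs' XiDeltaAbs' XigeqTwoAbs' XiDeltageqTwoAbs' PsiRDeltaI' PsiRDeltaII' XiIotaAbs' XiIotaDeltaEiAbs' XiIotaDeltaZeroAbs' XiIotageqOneAbs' XiIotaDeltaEigeqOneAbs' betaPiRDelta' : ℝ}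
    (hd : 0 < d) (hmu0 : 0 ≤ mu) (hmu : mu ≤ mu') (hmu1 : mu' < 1) (h1 : PsiToXi ≤ PsiToXi') (h2 : muPiToXii ≤ muPiToXii') (h3 : XiAbs ≤ XiAbs') (h4 : XiDeltaAbs ≤ XiDeltaAbs') (h5 : XigeqTwoAbs ≤ XigeqTwoAbs') (h6 : XiDeltageqTwoAbs ≤ XiDeltageqTwoAbs') (h7 : PsiRDeltaI ≤ PsiRDeltaI') (h8 : PsiRDeltaII ≤ PsiRDeltaII') (h9 : XiIotaAbs ≤ XiIotaAbs') (h10 : XiIotaDeltaEiAbs ≤ XiIotaDeltaEiAbs') (h11 : XiIotaDeltaZeroAbs ≤ XiIotaDeltaZeroAbs') (h12 : XiIotageqOneAbs ≤ XiIotageqOneAbs') (h13 : XiIotaDeltaEigeqOneAbs ≤ XiIotaDeltaEigeqOneAbs') (h14 : betaPiRDelta ≤ betaPiRDelta') (g1 : 0 ≤ PsiToXi) (g2 : 0 ≤ muPiToXii) (g3 : 0 ≤ XiAbs) (g4 : 0 ≤ XiDeltaAbs) (g5 : 0 ≤ XigeqTwoAbs) (g6 : 0 ≤ XiDeltageqTwoAbs)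 (g7 : 0 ≤ PsiRDeltaI) (g8 : 0 ≤ PsiRDeltaII) (g9 : 0 ≤ XiIotaAbs) (g10 : 0 ≤ XiIotaDeltaEiAbs) (g11 : 0 ≤ XiIotaDeltaZeroAbs) (g12 : 0 ≤ XiIotageqOneAbs) (g13 : 0 ≤ XiIotaDeltaEigeqOneAbs) (g14 : 0 ≤ betaPiRDelta) (ht : 2 * d * muPiToXii' / (1 - mu') * XiIotaAbs' < 1) :
    betaRfDelta d mu PsiToXi muPiToXii XiAbs XiDeltaAbs XigeqTwoAbs XiDeltageqTwoAbs PsiRDeltaI PsiRDeltaII XiIotaAbs XiIotaDeltaEiAbs XiIotaDeltaZeroAbs XiIotageqOneAbs XiIotaDeltaEigeqOneAbs betaPiRDelta ≤ betaRfDelta d mu' PsiToXi' muPiToXii' XiAbs' XiDeltaAbs' XigeqTwoAbs' XiDeltageqTwoAbs' PsiRDeltaI' PsiRDeltaII' XiIotaAbs' XiIotaDeltaEiAbs' XiIotaDeltaZeroAbs' XiIotageqOneAbs' XiIotaDeltaEigeqOneAbs' betaPiRDelta' := by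
  have g1' : 0 ≤ PsiToXi' := g1.trans h1
  have g2' : 0 ≤ muPiToXii' := g2.trans h2
  have g3' : 0 ≤ XiAbs' := g3.trans h3
  have g4' : 0 ≤ XiDeltaAbs' := g4.trans h4
  have g5' : 0 ≤ XigeqTwoAbs' := g5.trans h5
  have g6' : 0 ≤ XiDeltageqTwoAbs' := g6.trans h6
  have g7' : 0 ≤ PsiRDeltaI' := g7.trans h7
  have g8' : 0 ≤ PsiRDeltaII' := g8.trans h8
  have g9' : 0 ≤ XiIotaAbs' := g9.trans h9
  have g10' : 0 ≤ XiIotaDeltaEiAbs' := g10.trans h10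
  have g11' : 0 ≤ XiIotaDeltaZeroAbs' := g11.trans h11
  have g12' : 0 ≤ XiIotageqOneAbs' := g12.trans h12
  have g13' : 0 ≤ XiIotaDeltaEigeqOneAbs' := g13.trans h13
  have g14' : 0 ≤ betaPiRDelta' := g14.trans h14
  have hmu0' : 0 ≤ mu' := hmu0.trans hmu
  have e1 : 0 < 1 - mu := sub_pos.2 (lt_of_le_of_lt hmu hmu1)
  have e1' : 0 < 1 - mu' := sub_pos.2 hmu1
  have e2 : 0 < 1 - mu ^ 2 := one_sub_sq_pos hmu0 (lt_of_le_of_lt hmu hmu1)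
  have e2' : 0 < 1 - mu' ^ 2 := one_sub_sq_pos hmu0' hmu1
  have e3 : 0 < 1 + mu := by positivity
  have e3' : 0 < 1 + mu' := by positivity
  have t0 : 0 ≤ 2 * d * muPiToXii / (1 - mu) * XiIotaAbs := by positivity
  have t0' : 0 ≤ 2 * d * muPiToXii' / (1 - mu') * XiIotaAbs' := by positivity
  have tle : 2 * d * muPiToXii / (1 - mu) * XiIotaAbs ≤ 2 * d * muPiToXii' / (1 - mu') * XiIotaAbs' := by
    gcongr
  have f1 : 0 < 1 - 2 * d * muPiToXii / (1 - mu) * XiIotaAbs := by linarith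
  have f1' : 0 < 1 - 2 * d * muPiToXii' / (1 - mu') * XiIotaAbs' := by linarith
  have f2 : 0 ≤ 1 - 2 * d * muPiToXii / (1 - mu) * XiIotaAbs := f1.le
  have f2' : 0 ≤ 1 - 2 * d * muPiToXii' / (1 - mu') * XiIotaAbs' := f1'.le
  simp only [betaRfDelta]
  gcongr

set_option maxHeartbeats 1600000 in
/-- (D.32): `betaRfDeltaLower` is non-INCREASING in the information order on its arguments (on the region where the series ratio at the larger argument is `< 1`). [folklore] -/
theorem betaRfDeltaLower_anti_fn {d mu PsiToXi muPiToXii XiAbs XiOddAbs XiEvenAbs XiDeltaAbs XiDeltaOddAbs XiDeltaEvenAbs XigeqTwoOddAbs XiDeltageqTwoOddAbs XiDeltageqTwoEven PsiROneDeltaI PsiRZeroDeltaII XiIotaAbs XiIotaOddAbs XiIotaEvenAbs XiIotaDeltaEi XiIotaDeltaEiOdd XiIotaDeltaEiEven XiIotaDeltaZero XiIotaDeltaZeroOdd XiIotaDeltaZeroEven XiIotageqOneEven XiIotaDeltageqOneEven betaPiRDelta mu' PsiToXi' muPiToXii' XiAbs' XiOddAbs' XiEvenAbs' XiDeltaAbs'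 XiDeltaOddAbs' XiDeltaEvenAbs' XigeqTwoOddAbs' XiDeltageqTwoOddAbs' XiDeltageqTwoEven' PsiROneDeltaI' PsiRZeroDeltaII' XiIotaAbs' XiIotaOddAbs' XiIotaEvenAbs' XiIotaDeltaEi' XiIotaDeltaEiOdd' XiIotaDeltaEiEven' XiIotaDeltaZero' XiIotaDeltaZeroOdd' XiIotaDeltaZeroEven' XiIotageqOneEven' XiIotaDeltageqOneEven' betaPiRDelta' : ℝ}
    (hd : 0 < d) (hmu0 : 0 ≤ mu) (hmu : mu ≤ mu') (hmu1 : mu' < 1) (h1 : PsiToXi ≤ PsiToXi') (h2 : muPiToXii ≤ muPiToXii') (h3 : XiAbs ≤ XiAbs') (h4 : XiOddAbs ≤ XiOddAbs') (h5 : XiEvenAbs ≤ XiEvenAbs') (h6 : XiDeltaAbs ≤ XiDeltaAbs') (h7 : XiDeltaOddAbs ≤ XiDeltaOddAbs') (h8 : XiDeltaEvenAbs ≤ XiDeltaEvenAbs') (h9 : XigeqTwoOddAbs ≤ XigeqTwoOddAbs') (h10 : XiDeltageqTwoOddAbs ≤ XiDeltageqTwoOddAbs') (h11 : XiDeltageqTwoEven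 ≤ XiDeltageqTwoEven') (h12 : PsiROneDeltaI ≤ PsiROneDeltaI') (h13 : PsiRZeroDeltaII ≤ PsiRZeroDeltaII') (h14 : XiIotaAbs ≤ XiIotaAbs') (h15 : XiIotaOddAbs ≤ XiIotaOddAbs') (h16 : XiIotaEvenAbs ≤ XiIotaEvenAbs') (h17 : XiIotaDeltaEi ≤ XiIotaDeltaEi') (h18 : XiIotaDeltaEiOdd ≤ XiIotaDeltaEiOdd') (h19 : XiIotaDeltaEiEven ≤ XiIotaDeltaEiEven') (h20 : XiIotaDeltaZero ≤ XiIotaDeltaZero') (h21 : XiIotaDeltaZeroOdd ≤ XiIotaDeltaZeroOdd') (h22 : XiIotaDeltaZeroEven ≤ XiIotaDeltaZeroEven') (h23 : XiIotageqOneEven ≤ XiIotageqOneEven') (h24 : XiIotaDeltageqOneEven ≤ XiIotaDeltageqOneEven') (h25 : betaPiRDelta ≤ betaPiRDelta') (g1 : 0 ≤ PsiToXi) (g2 : 0 ≤ muPiToXii) (g3 : 0 ≤ XiAbs) (g4 : 0 ≤ XiOddAbs) (g5 : 0 ≤ XiEvenAbs) (g6 : 0 ≤ XiDeltaAbs) (g7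 : 0 ≤ XiDeltaOddAbs) (g8 : 0 ≤ XiDeltaEvenAbs) (g9 : 0 ≤ XigeqTwoOddAbs) (g10 : 0 ≤ XiDeltageqTwoOddAbs) (g11 : 0 ≤ XiDeltageqTwoEven) (g12 : 0 ≤ PsiROneDeltaI) (g13 : 0 ≤ PsiRZeroDeltaII) (g14 : 0 ≤ XiIotaAbs) (g15 : 0 ≤ XiIotaOddAbs) (g16 : 0 ≤ XiIotaEvenAbs) (g17 : 0 ≤ XiIotaDeltaEi) (g18 : 0 ≤ XiIotaDeltaEiOdd) (g19 : 0 ≤ XiIotaDeltaEiEven) (g20 : 0 ≤ XiIotaDeltaZero) (g21 : 0 ≤ XiIotaDeltaZeroOdd) (g22 : 0 ≤ XiIotaDeltaZeroEven) (g23 : 0 ≤ XiIotageqOneEven) (g24 : 0 ≤ XiIotaDeltageqOneEven) (g25 : 0 ≤ betaPiRDelta) (ht : 2 * d * muPiToXii' / (1 - mu') * XiIotaAbs' < 1) :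
    betaRfDeltaLower d mu' PsiToXi' muPiToXii' XiAbs' XiOddAbs' XiEvenAbs' XiDeltaAbs' XiDeltaOddAbs' XiDeltaEvenAbs' XigeqTwoOddAbs' XiDeltageqTwoOddAbs' XiDeltageqTwoEven' PsiROneDeltaI' PsiRZeroDeltaII' XiIotaAbs' XiIotaOddAbs' XiIotaEvenAbs' XiIotaDeltaEi' XiIotaDeltaEiOdd' XiIotaDeltaEiEven' XiIotaDeltaZero' XiIotaDeltaZeroOdd' XiIotaDeltaZeroEven' XiIotageqOneEven' XiIotaDeltageqOneEven' betaPiRDelta' ≤ betaRfDeltaLower d mu PsiToXi muPiToXii XiAbs XiOddAbs XiEvenAbs XiDeltaAbs XiDeltaOddAbs XiDeltaEvenAbs XigeqTwoOddAbs XiDeltageqTwoOddAbs XiDeltageqTwoEven PsiROneDeltaI PsiRZeroDeltaII XiIotaAbs XiIotaOddAbs XiIotaEvenAbs XiIotaDeltaEi XiIotaDeltaEiOdd XiIotaDeltaEiEven XiIotaDeltaZero XiIotaDeltaZeroOdd XiIotaDeltaZeroEven XiIotageqOneEven XiIotaDeltageqOneEven betaPiRDelta := by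
  have g1' : 0 ≤ PsiToXi' := g1.trans h1
  have g2' : 0 ≤ muPiToXii' := g2.trans h2
  have g3' : 0 ≤ XiAbs' := g3.trans h3
  have g4' : 0 ≤ XiOddAbs' := g4.trans h4
  have g5' : 0 ≤ XiEvenAbs' := g5.trans h5
  have g6' : 0 ≤ XiDeltaAbs' := g6.trans h6
  have g7' : 0 ≤ XiDeltaOddAbs' := g7.trans h7
  have g8' : 0 ≤ XiDeltaEvenAbs' := g8.trans h8
  have g9' : 0 ≤ XigeqTwoOddAbs' := g9.trans h9
  have g10' : 0 ≤ XiDeltageqTwoOddAbs' := g10.trans h10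
  have g11' : 0 ≤ XiDeltageqTwoEven' := g11.trans h11
  have g12' : 0 ≤ PsiROneDeltaI' := g12.trans h12
  have g13' : 0 ≤ PsiRZeroDeltaII' := g13.trans h13
  have g14' : 0 ≤ XiIotaAbs' := g14.trans h14
  have g15' : 0 ≤ XiIotaOddAbs' := g15.trans h15
  have g16' : 0 ≤ XiIotaEvenAbs' := g16.trans h16
  have g17' : 0 ≤ XiIotaDeltaEi' := g17.trans h17
  have g18' : 0 ≤ XiIotaDeltaEiOdd' := g18.trans h18
  have g19' : 0 ≤ XiIotaDeltaEiEven' := g19.trans h19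
  have g20' : 0 ≤ XiIotaDeltaZero' := g20.trans h20
  have g21' : 0 ≤ XiIotaDeltaZeroOdd' := g21.trans h21
  have g22' : 0 ≤ XiIotaDeltaZeroEven' := g22.trans h22
  have g23' : 0 ≤ XiIotageqOneEven' := g23.trans h23
  have g24' : 0 ≤ XiIotaDeltageqOneEven' := g24.trans h24
  have g25' : 0 ≤ betaPiRDelta' := g25.trans h25
  have hmu0' : 0 ≤ mu' := hmu0.trans hmu
  have e1 : 0 < 1 - mu := sub_pos.2 (lt_of_le_of_lt hmu hmu1)
  have e1' : 0 < 1 - mu' := sub_pos.2 hmu1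
  have e2 : 0 < 1 - mu ^ 2 := one_sub_sq_pos hmu0 (lt_of_le_of_lt hmu hmu1)
  have e2' : 0 < 1 - mu' ^ 2 := one_sub_sq_pos hmu0' hmu1
  have e3 : 0 < 1 + mu := by positivity
  have e3' : 0 < 1 + mu' := by positivity
  have t0 : 0 ≤ 2 * d * muPiToXii / (1 - mu) * XiIotaAbs := by positivity
  have t0' : 0 ≤ 2 * d * muPiToXii' / (1 - mu') * XiIotaAbs' := by positivity
  have tle : 2 * d * muPiToXii / (1 - mu) * XiIotaAbs ≤ 2 * d * muPiToXii' / (1 - mu') * XiIotaAbs' := by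
    gcongr
  have f1 : 0 < 1 - 2 * d * muPiToXii / (1 - mu) * XiIotaAbs := by linarith
  have f1' : 0 < 1 - 2 * d * muPiToXii' / (1 - mu') * XiIotaAbs' := by linarith
  have f2 : 0 ≤ 1 - 2 * d * muPiToXii / (1 - mu) * XiIotaAbs := f1.le
  have f2' : 0 ≤ 1 - 2 * d * muPiToXii' / (1 - mu') * XiIotaAbs' := f1'.le
  simp only [betaRfDeltaLower]
  gcongr

/-- The elementary inequality behind the `μ ≤ 7/10` cap: for `0 ≤ m ≤ m' ≤ 7/10`,
`m'/(1−m'²)/(1−m'²) − m/(1−m²)/(1−m²) ≤ 8·(m'/(1−m'²) − m/(1−m²))`.  (Clearing denominators `D = 1−m² ≥ 51/100`,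
`D' = 1−m'²`: `m'D² − mD'² = (m'−m)(1 + 2mm' − mm'(m²+mm'+m'²))` and `m'D − mD' = (m'−m)(1+mm')`.) [folklore] -/
theorem key_q_le_r {m m' : ℝ} (hm : 0 ≤ m) (hmm : m ≤ m') (hm' : m' ≤ 7 / 10) :
    m' / (1 - m' ^ 2) / (1 - m' ^ 2) - m / (1 - m ^ 2) / (1 - m ^ 2) ≤ 8 * (m' / (1 - m' ^ 2) - m / (1 - m ^ 2)) := by
  have hm'0 : 0 ≤ m' := hm.trans hmm
  have hm7 : m ≤ 7 / 10 := hmm.trans hm'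
  have hD : 51 / 100 ≤ 1 - m ^ 2 := by nlinarith
  have hD' : 51 / 100 ≤ 1 - m' ^ 2 := by nlinarith
  have hDpos : 0 < 1 - m ^ 2 := by linarith
  have hD'pos : 0 < 1 - m' ^ 2 := by linarith
  have hmm' : m * m' ≤ 49 / 100 := by nlinarith
  have hmm0 : 0 ≤ m * m' := mul_nonneg hm hm'0
  -- the polynomial core
  have hDD : 2601 / 10000 ≤ (1 - m ^ 2) * (1 - m' ^ 2) := by nlinarith [mul_nonneg (sub_nonneg.2 hD) (sub_nonneg.2 hD')]
  have core : 1 + 2 * m * m' - m * m' * (m ^ 2 + m * m' + m' ^ 2)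
      ≤ 8 * ((1 - m ^ 2) * (1 - m' ^ 2)) * (1 + m * m') := by
    have h3 : 0 ≤ m * m' * (m ^ 2 + m * m' + m' ^ 2) := by positivity
    nlinarith [mul_nonneg hmm0 (by linarith : (0:ℝ) ≤ (1 - m ^ 2) * (1 - m' ^ 2))]
  have poly : m' * (1 - m ^ 2) ^ 2 - m * (1 - m' ^ 2) ^ 2
      ≤ 8 * (1 - m ^ 2) * (1 - m' ^ 2) * (m' * (1 - m ^ 2) - m * (1 - m' ^ 2)) := by
    have c1 : m' * (1 - m ^ 2) ^ 2 - m * (1 - m' ^ 2) ^ 2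
        = (m' - m) * (1 + 2 * m * m' - m * m' * (m ^ 2 + m * m' + m' ^ 2)) := by ring
    have c2 : 8 * (1 - m ^ 2) * (1 - m' ^ 2) * (m' * (1 - m ^ 2) - m * (1 - m' ^ 2))
        = (m' - m) * (8 * ((1 - m ^ 2) * (1 - m' ^ 2)) * (1 + m * m')) := by ring
    rw [c1, c2]
    exact mul_le_mul_of_nonneg_left core (sub_nonneg.2 hmm)
  -- back to fractions: clear the (positive) denominators; the cleared form is `poly × (1−m²)(1−m'²)`
  have hnn : 0 ≤ (1 - m ^ 2) * (1 - m' ^ 2) := by positivity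
  have hx := mul_le_mul_of_nonneg_right poly hnn
  rw [div_div, div_div, div_sub_div _ _ (by positivity) (by positivity),
    div_sub_div _ _ (by positivity) (by positivity), ← mul_div_assoc,
    div_le_div_iff₀ (by positivity) (by positivity)]
  nlinarith [hx]

/-- (D.3), upper: `ᾱ_F = 2d·((1+A)·r(μ) + B·s(μ) − P·q(μ))` with `r = μ/(1−μ²)`, `s = μ²/(1−μ²)`, `q = μ/(1−μ²)/(1−μ²)` (= `μ/(1−μ²)²`).
[folklore] -/
theorem betaAfUp_eq (d mu A B P : ℝ) :
    betaAfUp d mu A B P = 2 * d * ((1 + A) * (mu / (1 - mu ^ 2)) + B * (mu ^ 2 / (1 - mu ^ 2)) - P * (mu / (1 - mu ^ 2) / (1 - mu ^ 2))) := by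
  simp only [betaAfUp]
  ring

/-- (D.3), upper: `ᾱ_F` is non-decreasing in the information order (`mu`, `A = β_{ΣΨα,I}`, `B = β_{ΣΨα,II}` up, the LOWER
bound `P = β̲_{ΣΠα}` down) on the capped region `0 ≤ mu ≤ mu' ≤ 7/10`, `P' ≤ 1/8`.  Without the caps it is false
(the subtracted term `2d·P·μ/(1−μ²)²` dominates as `μ → 1`). [folklore] -/
theorem betaAfUp_mono_fn {d mu A B P mu' A' B' P' : ℝ} (hd : 0 < d) (hmu0 : 0 ≤ mu) (hmu : mu ≤ mu')
    (hcap : mu' ≤ 7 / 10) (h1 : A ≤ A') (h2 : B ≤ B') (h3 : P' ≤ P) (g1 : 0 ≤ A) (g2 : 0 ≤ B) (hP : P' ≤ 1 / 8) :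
    betaAfUp d mu A B P ≤ betaAfUp d mu' A' B' P' := by
  have hmu0' : 0 ≤ mu' := hmu0.trans hmu
  have g1' : 0 ≤ A' := g1.trans h1
  have g2' : 0 ≤ B' := g2.trans h2
  have e2 : 0 < 1 - mu ^ 2 := by nlinarith
  have e2' : 0 < 1 - mu' ^ 2 := by nlinarith
  -- step 1: vary (A, B, P) at fixed mu
  have step1 : betaAfUp d mu A B P ≤ betaAfUp d mu A' B' P' := by
    simp only [betaAfUp]
    apply mul_le_mul_of_nonneg_left _ (by positivity)
    gcongr
  -- step 2: vary mu at fixed (A', B', P')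
  have hr : mu / (1 - mu ^ 2) ≤ mu' / (1 - mu' ^ 2) := by
    gcongr
  have hs : mu ^ 2 / (1 - mu ^ 2) ≤ mu' ^ 2 / (1 - mu' ^ 2) := by
    gcongr
  have hq : mu / (1 - mu ^ 2) / (1 - mu ^ 2) ≤ mu' / (1 - mu' ^ 2) / (1 - mu' ^ 2) := by
    gcongr
  have key := key_q_le_r hmu0 hmu hcap
  have step2 : betaAfUp d mu A' B' P' ≤ betaAfUp d mu' A' B' P' := by
    rw [betaAfUp_eq, betaAfUp_eq]
    apply mul_le_mul_of_nonneg_left _ (by positivity)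
    nlinarith [mul_nonneg g1' (sub_nonneg.2 hr), mul_nonneg g2' (sub_nonneg.2 hs),
      mul_nonneg (sub_nonneg.2 hP) (sub_nonneg.2 hq)]
  exact step1.trans step2


/-- (D.2), upper: `betaCPhiUp` is `≥ 1` on the well-formed region. [folklore] -/
theorem one_le_betaCPhiUp_fn {d mu XiZerominusOneAtZero XiIotaAlphaII : ℝ}
    (hd : 0 < d) (hmu0 : 0 ≤ mu) (hmu1 : mu < 1) (g1 : 0 ≤ XiZerominusOneAtZero) (g2 : 0 ≤ XiIotaAlphaII) :
    1 ≤ betaCPhiUp d mu XiZerominusOneAtZero XiIotaAlphaII := by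
  have e1 : 0 < 1 - mu := sub_pos.2 hmu1
  have e2 : 0 < 1 - mu ^ 2 := one_sub_sq_pos hmu0 hmu1
  have e3 : 0 < 1 + mu := by positivity
  simp only [betaCPhiUp]
  have : 0 ≤ XiZerominusOneAtZero + (2*d*mu^2)/(1-mu^2)*XiIotaAlphaII := by positivity
  linarith

/-- (D.4), member I: `betaapI` is `≥ 0` on the well-formed region. [folklore] -/
theorem betaapI_nonneg_fn {d mu XiOneminusZeroAlphaIei XiIotaAlphaIsumei : ℝ}
    (hd : 0 < d) (hmu0 : 0 ≤ mu) (hmu1 : mu < 1) (g1 : 0 ≤ XiOneminusZeroAlphaIei) (g2 : 0 ≤ XiIotaAlphaIsumei) :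
    0 ≤ betaapI d mu XiOneminusZeroAlphaIei XiIotaAlphaIsumei := by
  have e1 : 0 < 1 - mu := sub_pos.2 hmu1
  have e2 : 0 < 1 - mu ^ 2 := one_sub_sq_pos hmu0 hmu1
  have e3 : 0 < 1 + mu := by positivity
  simp only [betaapI]
  positivity

/-- (D.4), member II: `betaapII` is `≥ 0` on the well-formed region. [folklore] -/
theorem betaapII_nonneg_fn {d mu XiZerominusOneAlphaIei XiIotaAlphaIIsumzero : ℝ}
    (hd : 0 < d) (hmu0 : 0 ≤ mu) (hmu1 : mu < 1) (g1 : 0 ≤ XiZerominusOneAlphaIei) (g2 : 0 ≤ XiIotaAlphaIIsumzero) :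
    0 ≤ betaapII d mu XiZerominusOneAlphaIei XiIotaAlphaIIsumzero := by
  have e1 : 0 < 1 - mu := sub_pos.2 hmu1
  have e2 : 0 < 1 - mu ^ 2 := one_sub_sq_pos hmu0 hmu1
  have e3 : 0 < 1 + mu := by positivity
  simp only [betaapII]
  positivity

/-- (D.14): `betaRp` is `≥ 0` on the well-formed region (series ratio `< 1`). [folklore] -/
theorem betaRp_nonneg_fn {d mu muPsiToXi muPiToXiIota XiAbs XiR XigeqTwoAbs XiIotaAbs XiIotageqOneAbs XiIotaRI XiIotaRII : ℝ}
    (hd : 0 < d) (hmu0 : 0 ≤ mu) (hmu1 : mu < 1) (g1 : 0 ≤ muPsiToXi) (g2 : 0 ≤ muPiToXiIota) (g3 : 0 ≤ XiAbs) (g4 : 0 ≤ XiR) (g5 : 0 ≤ XigeqTwoAbs) (g6 : 0 ≤ XiIotaAbs) (g7 : 0 ≤ XiIotageqOneAbs) (g8 : 0 ≤ XiIotaRI) (g9 : 0 ≤ XiIotaRII) (ht : 2 * d * muPiToXiIota / (1 - mu) * XiIotaAbs < 1) :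
    0 ≤ betaRp d mu muPsiToXi muPiToXiIota XiAbs XiR XigeqTwoAbs XiIotaAbs XiIotageqOneAbs XiIotaRI XiIotaRII := by
  have e1 : 0 < 1 - mu := sub_pos.2 hmu1
  have e2 : 0 < 1 - mu ^ 2 := one_sub_sq_pos hmu0 hmu1
  have e3 : 0 < 1 + mu := by positivity
  have t0 : 0 ≤ 2 * d * muPiToXiIota / (1 - mu) * XiIotaAbs := by positivity
  have f1 : 0 < 1 - 2 * d * muPiToXiIota / (1 - mu) * XiIotaAbs := by linarith
  have f2 : 0 ≤ 1 - 2 * d * muPiToXiIota / (1 - mu) * XiIotaAbs := f1.le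
  simp only [betaRp]
  positivity

/-- (D.13): `betaRF` is `≥ 0` on the well-formed region (series ratio `< 1`). [folklore] -/
theorem betaRF_nonneg_fn {d mu mubar PsiToXi muPiToXii XiAbs XigeqTwoAbs XiIotaAbs XiIotageqOneAbs PsiRI PsiRII PiR : ℝ}
    (hd : 0 < d) (hmu0 : 0 ≤ mu) (hmu1 : mu < 1) (g1 : 0 ≤ mubar) (g2 : 0 ≤ PsiToXi) (g3 : 0 ≤ muPiToXii) (g4 : 0 ≤ XiAbs) (g5 : 0 ≤ XigeqTwoAbs) (g6 : 0 ≤ XiIotaAbs) (g7 : 0 ≤ XiIotageqOneAbs) (g8 : 0 ≤ PsiRI) (g9 : 0 ≤ PsiRII) (g10 : 0 ≤ PiR) (ht : 2 * d * muPiToXii / (1 - mu) * XiIotaAbs < 1) :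
    0 ≤ betaRF d mu mubar PsiToXi muPiToXii XiAbs XigeqTwoAbs XiIotaAbs XiIotageqOneAbs PsiRI PsiRII PiR := by
  have e1 : 0 < 1 - mu := sub_pos.2 hmu1
  have e2 : 0 < 1 - mu ^ 2 := one_sub_sq_pos hmu0 hmu1
  have e3 : 0 < 1 + mu := by positivity
  have t0 : 0 ≤ 2 * d * muPiToXii / (1 - mu) * XiIotaAbs := by positivity
  have f1 : 0 < 1 - 2 * d * muPiToXii / (1 - mu) * XiIotaAbs := by linarith
  have f2 : 0 ≤ 1 - 2 * d * muPiToXii / (1 - mu) * XiIotaAbs := f1.le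
  simp only [betaRF]
  positivity

/-- (D.21): `betaRpDelta` is `≥ 0` on the well-formed region (series ratio `< 1`). [folklore] -/
theorem betaRpDelta_nonneg_fn {d mu PsiToXi muPiToXii XiAbs XiDeltaAbs XiDeltaR XiDeltageqTwoAbs XiIotaAbs XiIotaDeltaEiAbs XiIotaDeltaZeroAbs XiIotaDeltaEigeqOneAbs XiIotaDeltaZerogeqOneAbs XiIotaDeltaRI XiIotaDeltaRII : ℝ}
    (hd : 0 < d) (hmu0 : 0 ≤ mu) (hmu1 : mu < 1) (g1 : 0 ≤ PsiToXi) (g2 : 0 ≤ muPiToXii) (g3 : 0 ≤ XiAbs) (g4 : 0 ≤ XiDeltaAbs) (g5 : 0 ≤ XiDeltaR) (g6 : 0 ≤ XiDeltageqTwoAbs) (g7 : 0 ≤ XiIotaAbs) (g8 : 0 ≤ XiIotaDeltaEiAbs) (g9 : 0 ≤ XiIotaDeltaZeroAbs) (g10 : 0 ≤ XiIotaDeltaEigeqOneAbs) (g11 : 0 ≤ XiIotaDeltaZerogeqOneAbs) (g12 : 0 ≤ XiIotaDeltaRI) (g13 : 0 ≤ XiIotaDeltaRII) (ht : 2 * d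 * muPiToXii / (1 - mu) * XiIotaAbs < 1) :
    0 ≤ betaRpDelta d mu PsiToXi muPiToXii XiAbs XiDeltaAbs XiDeltaR XiDeltageqTwoAbs XiIotaAbs XiIotaDeltaEiAbs XiIotaDeltaZeroAbs XiIotaDeltaEigeqOneAbs XiIotaDeltaZerogeqOneAbs XiIotaDeltaRI XiIotaDeltaRII := by
  have e1 : 0 < 1 - mu := sub_pos.2 hmu1
  have e2 : 0 < 1 - mu ^ 2 := one_sub_sq_pos hmu0 hmu1
  have e3 : 0 < 1 + mu := by positivity
  have t0 : 0 ≤ 2 * d * muPiToXii / (1 - mu) * XiIotaAbs := by positivity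
  have f1 : 0 < 1 - 2 * d * muPiToXii / (1 - mu) * XiIotaAbs := by linarith
  have f2 : 0 ≤ 1 - 2 * d * muPiToXii / (1 - mu) * XiIotaAbs := f1.le
  simp only [betaRpDelta]
  positivity

set_option maxHeartbeats 1600000 in
/-- (D.29): `betaRfDelta` is `≥ 0` on the well-formed region (series ratio `< 1`). [folklore] -/
theorem betaRfDelta_nonneg_fn {d mu PsiToXi muPiToXii XiAbs XiDeltaAbs XigeqTwoAbs XiDeltageqTwoAbs PsiRDeltaI PsiRDeltaII XiIotaAbs XiIotaDeltaEiAbs XiIotaDeltaZeroAbs XiIotageqOneAbs XiIotaDeltaEigeqOneAbs betaPiRDelta : ℝ}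
    (hd : 0 < d) (hmu0 : 0 ≤ mu) (hmu1 : mu < 1) (g1 : 0 ≤ PsiToXi) (g2 : 0 ≤ muPiToXii) (g3 : 0 ≤ XiAbs) (g4 : 0 ≤ XiDeltaAbs) (g5 : 0 ≤ XigeqTwoAbs) (g6 : 0 ≤ XiDeltageqTwoAbs) (g7 : 0 ≤ PsiRDeltaI) (g8 : 0 ≤ PsiRDeltaII) (g9 : 0 ≤ XiIotaAbs) (g10 : 0 ≤ XiIotaDeltaEiAbs) (g11 : 0 ≤ XiIotaDeltaZeroAbs) (g12 : 0 ≤ XiIotageqOneAbs) (g13 : 0 ≤ XiIotaDeltaEigeqOneAbs) (g14 : 0 ≤ betaPiRDelta) (ht : 2 * d * muPiToXii / (1 - mu) * XiIotaAbs < 1) :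
    0 ≤ betaRfDelta d mu PsiToXi muPiToXii XiAbs XiDeltaAbs XigeqTwoAbs XiDeltageqTwoAbs PsiRDeltaI PsiRDeltaII XiIotaAbs XiIotaDeltaEiAbs XiIotaDeltaZeroAbs XiIotageqOneAbs XiIotaDeltaEigeqOneAbs betaPiRDelta := by
  have e1 : 0 < 1 - mu := sub_pos.2 hmu1
  have e2 : 0 < 1 - mu ^ 2 := one_sub_sq_pos hmu0 hmu1
  have e3 : 0 < 1 + mu := by positivity
  have t0 : 0 ≤ 2 * d * muPiToXii / (1 - mu) * XiIotaAbs := by positivity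
  have f1 : 0 < 1 - 2 * d * muPiToXii / (1 - mu) * XiIotaAbs := by linarith
  have f2 : 0 ≤ 1 - 2 * d * muPiToXii / (1 - mu) * XiIotaAbs := f1.le
  simp only [betaRfDelta]
  positivity

set_option maxHeartbeats 1600000 in
/-- (D.32): `betaRfDeltaLower` is `≤ 0` on the well-formed region (series ratio `< 1`). [folklore] -/
theorem betaRfDeltaLower_nonpos_fn {d mu PsiToXi muPiToXii XiAbs XiOddAbs XiEvenAbs XiDeltaAbs XiDeltaOddAbs XiDeltaEvenAbs XigeqTwoOddAbs XiDeltageqTwoOddAbs XiDeltageqTwoEven PsiROneDeltaI PsiRZeroDeltaII XiIotaAbs XiIotaOddAbs XiIotaEvenAbs XiIotaDeltaEi XiIotaDeltaEiOdd XiIotaDeltaEiEven XiIotaDeltaZero XiIotaDeltaZeroOdd XiIotaDeltaZeroEven XiIotageqOneEven XiIotaDeltageqOneEven betaPiRDelta : ℝ}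
    (hd : 0 < d) (hmu0 : 0 ≤ mu) (hmu1 : mu < 1) (g1 : 0 ≤ PsiToXi) (g2 : 0 ≤ muPiToXii) (g3 : 0 ≤ XiAbs) (g4 : 0 ≤ XiOddAbs) (g5 : 0 ≤ XiEvenAbs) (g6 : 0 ≤ XiDeltaAbs) (g7 : 0 ≤ XiDeltaOddAbs) (g8 : 0 ≤ XiDeltaEvenAbs) (g9 : 0 ≤ XigeqTwoOddAbs) (g10 : 0 ≤ XiDeltageqTwoOddAbs) (g11 : 0 ≤ XiDeltageqTwoEven) (g12 : 0 ≤ PsiROneDeltaI) (g13 : 0 ≤ PsiRZeroDeltaII) (g14 : 0 ≤ XiIotaAbs) (g15 : 0 ≤ XiIotaOddAbs) (g16 : 0 ≤ XiIotaEvenAbs) (g17 : 0 ≤ XiIotaDeltaEi) (g18 : 0 ≤ XiIotaDeltaEiOdd) (g19 : 0 ≤ XiIotaDeltaEiEven) (g20 : 0 ≤ XiIotaDeltaZero) (g21 : 0 ≤ XiIotaDeltaZeroOdd) (g22 : 0 ≤ XiIotaDeltaZeroEven) (g23 : 0 ≤ XiIotageqOneEven) (g24 : 0 ≤ XiIotaDeltageqOneEven)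 (g25 : 0 ≤ betaPiRDelta) (ht : 2 * d * muPiToXii / (1 - mu) * XiIotaAbs < 1) :
    betaRfDeltaLower d mu PsiToXi muPiToXii XiAbs XiOddAbs XiEvenAbs XiDeltaAbs XiDeltaOddAbs XiDeltaEvenAbs XigeqTwoOddAbs XiDeltageqTwoOddAbs XiDeltageqTwoEven PsiROneDeltaI PsiRZeroDeltaII XiIotaAbs XiIotaOddAbs XiIotaEvenAbs XiIotaDeltaEi XiIotaDeltaEiOdd XiIotaDeltaEiEven XiIotaDeltaZero XiIotaDeltaZeroOdd XiIotaDeltaZeroEven XiIotageqOneEven XiIotaDeltageqOneEven betaPiRDelta ≤ 0 := by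
  have e1 : 0 < 1 - mu := sub_pos.2 hmu1
  have e2 : 0 < 1 - mu ^ 2 := one_sub_sq_pos hmu0 hmu1
  have e3 : 0 < 1 + mu := by positivity
  have t0 : 0 ≤ 2 * d * muPiToXii / (1 - mu) * XiIotaAbs := by positivity
  have f1 : 0 < 1 - 2 * d * muPiToXii / (1 - mu) * XiIotaAbs := by linarith
  have f2 : 0 ≤ 1 - 2 * d * muPiToXii / (1 - mu) * XiIotaAbs := f1.le
  have x1 : 0 ≤ (2*d*mu)/(1-mu)*PsiToXi*XiDeltaAbs*(((2*d*muPiToXii)/(1-mu)*XiIotaAbs)^2)/(1-((2*d*muPiToXii)/(1-mu)*XiIotaAbs)) := by positivity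
  have x2 : 0 ≤ ((2*d)^2*mu*muPiToXii)/((1-mu^2)*(1-mu))*((2*d*muPiToXii)/(1-mu)*XiIotaAbs)/((1-((2*d*muPiToXii)/(1-mu)*XiIotaAbs))^2)*(1+PsiToXi*XiAbs)*(XiIotaDeltaEi + mu*XiIotaDeltaZero) := by positivity
  have x3 : 0 ≤ ((2*d)^2*mu*muPiToXii)/((1-mu^2)*(1-mu))*((2*d*muPiToXii)/(1-mu)*XiIotaAbs)/(1-((2*d*muPiToXii)/(1-mu)*XiIotaAbs))*(1+PsiToXi*XiAbs)*(XiIotaDeltaEi + mu*XiIotaDeltaZero + XiIotaAbs) := by positivity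
  have x4 : 0 ≤ (2*d*mu)/(1-mu^2)*(PsiROneDeltaI + mu*PsiRZeroDeltaII + PsiToXi*(XiDeltageqTwoOddAbs + XigeqTwoOddAbs + mu*XiDeltageqTwoEven)) := by positivity
  have x5 : 0 ≤ mu/((1-mu^2)^2)*(betaPiRDelta + (2*d)^2*muPiToXii*(XiIotaDeltageqOneEven + XiIotageqOneEven)) := by positivity
  have x6 : 0 ≤ ((2*d)^2*muPiToXii*mu^2)/((1-mu^2)^2)*(XiIotaDeltaEiOdd + XiIotaDeltaZeroOdd + XiIotaOddAbs + mu*XiIotaDeltaZeroEven) := by positivity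
  have x7 : 0 ≤ ((2*d)^2*muPiToXii*mu)/((1-mu^2)^2)*(XiDeltaOddAbs*XiIotaOddAbs*(1+mu^2) + 2*mu*XiDeltaEvenAbs*XiIotaEvenAbs) := by positivity
  have x8 : 0 ≤ ((2*d)^2*muPiToXii*mu)/((1-mu^2)^2)*XiOddAbs*(XiIotaDeltaEiOdd + XiIotaOddAbs + mu*XiIotaDeltaZeroEven + mu*XiIotaEvenAbs + mu*XiIotaDeltaEiEven + mu^2*XiIotaDeltaZeroOdd) := by positivity
  have x9 : 0 ≤ ((2*d)^2*muPiToXii*mu)/((1-mu^2)*(1-mu))*XiEvenAbs*(XiIotaDeltaEiEven + XiIotaEvenAbs + mu*XiIotaDeltaZeroOdd + mu*XiIotaOddAbs + mu*XiIotaDeltaEiOdd + mu^2*XiIotaDeltaZeroEven) := by positivity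
  simp only [betaRfDeltaLower]
  linarith

/-- The BOX MINORANT of (D.3) upper: for a box of states with `μ ≤ m₂ < 1` and the floor value `P₀ ≥ β̲_{ΣΠα}` of the
(antitone) lower bound, `ᾱ_F ≥ 2d·((1+A)·r(μ) + B·s(μ) − max(P₀,0)·q(m₂))` =: `betaAfUpBox`; unlike `ᾱ_F` itself it is
monotone in `(μ, A, B)` on all of `[0,1)` with no cap.  Used by `NoGoFrame` for boxes reaching beyond `μ = 7/10`.
[folklore] -/
def betaAfUpBox (d mu A B P0 m2 : ℝ) : ℝ :=
  2 * d * ((1 + A) * (mu / (1 - mu ^ 2)) + B * (mu ^ 2 / (1 - mu ^ 2)) - max P0 0 * (m2 / (1 - m2 ^ 2) / (1 - m2 ^ 2)))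

/-- `betaAfUpBox ≤ betaAfUp` on the box (`0 ≤ mu ≤ m2 < 1`, `P ≤ P0`). [folklore] -/
theorem betaAfUpBox_le {d mu A B P P0 m2 : ℝ} (hd : 0 < d) (hmu0 : 0 ≤ mu) (hm2 : mu ≤ m2) (hm21 : m2 < 1)
    (hP : P ≤ P0) : betaAfUpBox d mu A B P0 m2 ≤ betaAfUp d mu A B P := by
  rw [betaAfUp_eq]
  unfold betaAfUpBox
  have e2 : 0 < 1 - mu ^ 2 := one_sub_sq_pos hmu0 (lt_of_le_of_lt hm2 hm21)
  have e2' : 0 < 1 - m2 ^ 2 := one_sub_sq_pos (hmu0.trans hm2) hm21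
  have hq0 : 0 ≤ mu / (1 - mu ^ 2) / (1 - mu ^ 2) := by positivity
  have hm20 : 0 ≤ m2 := hmu0.trans hm2
  have hq : mu / (1 - mu ^ 2) / (1 - mu ^ 2) ≤ m2 / (1 - m2 ^ 2) / (1 - m2 ^ 2) := by
    gcongr
  have h1 : P * (mu / (1 - mu ^ 2) / (1 - mu ^ 2)) ≤ max P0 0 * (mu / (1 - mu ^ 2) / (1 - mu ^ 2)) :=
    mul_le_mul_of_nonneg_right (hP.trans (le_max_left _ _)) hq0
  have h2 : max P0 0 * (mu / (1 - mu ^ 2) / (1 - mu ^ 2)) ≤ max P0 0 * (m2 / (1 - m2 ^ 2) / (1 - m2 ^ 2)) :=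
    mul_le_mul_of_nonneg_left hq (le_max_right _ _)
  have h2d : 0 ≤ 2 * d := by positivity
  apply mul_le_mul_of_nonneg_left _ h2d
  linarith

/-- `betaAfUpBox` is non-decreasing in `(mu, A, B)` on `0 ≤ mu ≤ mu' < 1`, `0 ≤ A ≤ A'`, `0 ≤ B ≤ B'` (no cap). [folklore] -/
theorem betaAfUpBox_mono_fn {d mu A B mu' A' B' P0 m2 : ℝ} (hd : 0 < d) (hmu0 : 0 ≤ mu) (hmu : mu ≤ mu')
    (hmu1 : mu' < 1) (h1 : A ≤ A') (h2 : B ≤ B') (g1 : 0 ≤ A) (g2 : 0 ≤ B) :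
    betaAfUpBox d mu A B P0 m2 ≤ betaAfUpBox d mu' A' B' P0 m2 := by
  unfold betaAfUpBox
  have hmu0' : 0 ≤ mu' := hmu0.trans hmu
  have g1' : 0 ≤ A' := g1.trans h1
  have e2 : 0 < 1 - mu ^ 2 := one_sub_sq_pos hmu0 (lt_of_le_of_lt hmu hmu1)
  have e2' : 0 < 1 - mu' ^ 2 := one_sub_sq_pos hmu0' hmu1
  have hr : mu / (1 - mu ^ 2) ≤ mu' / (1 - mu' ^ 2) := by
    gcongr
  have hs : mu ^ 2 / (1 - mu ^ 2) ≤ mu' ^ 2 / (1 - mu' ^ 2) := by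
    gcongr
  have h2d : 0 ≤ 2 * d := by positivity
  apply mul_le_mul_of_nonneg_left _ h2d
  have p1 : (1 + A) * (mu / (1 - mu ^ 2)) ≤ (1 + A') * (mu' / (1 - mu' ^ 2)) :=
    mul_le_mul (by linarith) hr (by positivity) (by linarith)
  have p2 : B * (mu ^ 2 / (1 - mu ^ 2)) ≤ B' * (mu' ^ 2 / (1 - mu' ^ 2)) :=
    mul_le_mul h2 hs (by positivity) (g2.trans h2)
  linarith


end Fn

/-! ## Record-level corollaries along `Inputs.Dom` on the well-formed region -/

section Record

variable {d : ℝ} {a b : Inputs}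

/-- (D.1) `β_μ` along `Inputs.Dom` between well-formed records (`1 ≤ d`). [folklore] -/
theorem betaMu_mono (hd : 1 ≤ d) (ha : a.WF d) (hb : b.WF d) (h : a.Dom b) :
    (nobleBetaOfInputs d a).βμ ≤ (nobleBetaOfInputs d b).βμ := by
  have F := ha.facts hd; have F' := hb.facts hd
  simp only [nobleBetaOfInputs]
  exact betaMubarOverMu_mono_fn h.mubOverMu ha.mubOverMu

/-- (D.5) `β_Π̂` along `Inputs.Dom` between well-formed records (`1 ≤ d`). [folklore] -/
theorem betaPi_mono (hd : 1 ≤ d) (ha : a.WF d) (hb : b.WF d) (h : a.Dom b) :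
    (nobleBetaOfInputs d a).βPi ≤ (nobleBetaOfInputs d b).βPi := by
  have F := ha.facts hd; have F' := hb.facts hd
  simp only [nobleBetaOfInputs]
  exact betaPiHat_mono_fn F.d_pos (mul_le_mul_of_nonneg_left h.mub F.perc_nonneg) h.xiIotaEven h.piOneLower (mul_nonneg F.perc_nonneg ha.mub) ha.xiIotaEven

/-- (D.5) `β_Ψ̂` along `Inputs.Dom` between well-formed records (`1 ≤ d`). [folklore] -/
theorem betaPsi_mono (hd : 1 ≤ d) (ha : a.WF d) (hb : b.WF d) (h : a.Dom b) :
    (nobleBetaOfInputs d a).βΨ ≤ (nobleBetaOfInputs d b).βΨ := by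
  have F := ha.facts hd; have F' := hb.facts hd
  simp only [nobleBetaOfInputs]
  exact betaPsiHatLower_mono_fn (mul_le_mul_of_nonneg_left h.mubOverMu F.perc_nonneg) h.xiOdd h.psiZeroLower (mul_nonneg F.perc_nonneg ha.mubOverMu) ha.xiOdd

/-- (D.2) `c̄_Φ` along `Inputs.Dom` between well-formed records (`1 ≤ d`). [folklore] -/
theorem cPhiUp_mono (hd : 1 ≤ d) (ha : a.WF d) (hb : b.WF d) (h : a.Dom b) :
    (nobleBetaOfInputs d a).cΦup ≤ (nobleBetaOfInputs d b).cΦup := by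
  have F := ha.facts hd; have F' := hb.facts hd
  simp only [nobleBetaOfInputs]
  exact betaCPhiUp_mono_fn F.d_pos ha.mu_nonneg h.mu hb.mu_lt_one h.xiAlphaZeroMinusOneAtZero h.xiIotaAlphaIIAtZero ha.xiAlphaZeroMinusOneAtZero ha.xiIotaAlphaIIAtZero

/-- (D.14) `β_{R,Φ}` along `Inputs.Dom` between well-formed records (`1 ≤ d`). [folklore] -/
theorem betaRPhi_mono (hd : 1 ≤ d) (ha : a.WF d) (hb : b.WF d) (h : a.Dom b) :
    (nobleBetaOfInputs d a).βRΦ ≤ (nobleBetaOfInputs d b).βRΦ := by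
  have F := ha.facts hd; have F' := hb.facts hd
  simp only [nobleBetaOfInputs]
  exact betaRp_mono_fn F.d_pos ha.mu_nonneg h.mu hb.mu_lt_one (mul_le_mul_of_nonneg_left h.mubOverMu F.perc_nonneg) (mul_le_mul_of_nonneg_left h.mub F.perc_nonneg) h.xiAbs (add_le_add h.xiR0 h.xiR1) (add_le_add h.xiEvenTail h.xiOddTail) h.xiIotaAbs (add_le_add h.xiIotaOdd h.xiIotaEvenTail) h.xiIotaRI0 h.xiIotaRII0 (mul_nonneg F.perc_nonneg ha.mubOverMu) (mul_nonneg F.perc_nonneg ha.mub) ha.xiAbs (add_nonneg ha.xiR0 ha.xiR1) (add_nonneg ha.xiEvenTail ha.xiOddTail) ha.xiIotaAbs (add_nonneg ha.xiIotaOdd ha.xiIotaEvenTail) ha.xiIotaRI0 ha.xiIotaRII0 F'.tmp1_lt_one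

/-- (D.13) `β_{R,F}` along `Inputs.Dom` between well-formed records (`1 ≤ d`). [folklore] -/
theorem betaRF_mono (hd : 1 ≤ d) (ha : a.WF d) (hb : b.WF d) (h : a.Dom b) :
    extraOfInputs d a 2 ≤ extraOfInputs d b 2 := by
  have F := ha.facts hd; have F' := hb.facts hd
  simp only [extraOfInputs, Matrix.cons_val]
  exact betaRF_mono_fn F.d_pos ha.mu_nonneg h.mu hb.mu_lt_one h.mub (mul_le_mul_of_nonneg_left h.mubOverMu F.perc_nonneg) (mul_le_mul_of_nonneg_left h.mub F.perc_nonneg) h.xiAbs (add_le_add h.xiEvenTail h.xiOddTail) h.xiIotaAbs (add_le_add h.xiIotaOdd h.xiIotaEvenTail) (add_le_add h.psiRI0 h.psiRI1) (add_le_add h.psiRII0 h.psiRII1) h.piR0 ha.mub (mul_nonneg F.perc_nonneg ha.mubOverMu) (mul_nonneg F.perc_nonneg ha.mub) ha.xiAbs (add_nonneg ha.xiEvenTail ha.xiOddTail) ha.xiIotaAbs (add_nonneg ha.xiIotaOdd ha.xiIotaEvenTail) (add_nonneg ha.psiRI0 ha.psiRI1) (add_nonneg ha.psiRII0 ha.psiRII1)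 ha.piR0 F'.tmp1_lt_one

/-- (D.21) `β_{ΔR,Φ}` (as printed, weighted constants) along `Inputs.Dom` between well-formed records (`1 ≤ d`). [folklore] -/
theorem betaRpDelta_mono (hd : 1 ≤ d) (ha : a.WF d) (hb : b.WF d) (h : a.Dom b) :
    extraOfInputs d a 3 ≤ extraOfInputs d b 3 := by
  have F := ha.facts hd; have F' := hb.facts hd
  simp only [extraOfInputs, Matrix.cons_val]
  exact betaRpDelta_mono_fn F.d_pos ha.mu_nonneg h.mu hb.mu_lt_one h.mubOverMu h.mub h.xiAbs h.xiDeltaAbs (add_le_add h.xiR0Delta h.xiR1Delta) (add_le_add h.xiOddTailDelta h.xiEvenTailDelta) h.xiIotaAbs h.xiIotaDeltaEi h.xiIotaDeltaZero (add_le_add h.xiIotaOddDeltaEi h.xiIotaEvenTailDeltaEi) (add_le_add h.xiIotaOddDeltaZero h.xiIotaEvenTailDeltaZero) h.xiIotaRI0DeltaEi h.xiIotaRII0DeltaZero ha.mubOverMu ha.mub ha.xiAbs ha.xiDeltaAbs (add_nonneg ha.xiR0Delta ha.xiR1Delta) (add_nonneg ha.xiOddTailDelta ha.xiEvenTailDelta)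 ha.xiIotaAbs ha.xiIotaDeltaEi ha.xiIotaDeltaZero (add_nonneg ha.xiIotaOddDeltaEi ha.xiIotaEvenTailDeltaEi) (add_nonneg ha.xiIotaOddDeltaZero ha.xiIotaEvenTailDeltaZero) ha.xiIotaRI0DeltaEi ha.xiIotaRII0DeltaZero hb.tmp2_lt_one

/-- (D.29) `β_{|ΔR,F|}` along `Inputs.Dom` between well-formed records (`1 ≤ d`). [folklore] -/
theorem betaRfDelta_mono (hd : 1 ≤ d) (ha : a.WF d) (hb : b.WF d) (h : a.Dom b) :
    extraOfInputs d a 4 ≤ extraOfInputs d b 4 := by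
  have F := ha.facts hd; have F' := hb.facts hd
  simp only [extraOfInputs, Matrix.cons_val]
  exact betaRfDelta_mono_fn F.d_pos ha.mu_nonneg h.mu hb.mu_lt_one h.mubOverMu h.mub h.xiAbs h.xiDeltaAbs (add_le_add h.xiEvenTail h.xiOddTail) (add_le_add h.xiOddTailDelta h.xiEvenTailDelta) (add_le_add h.psiRI0Delta h.psiRI1Delta) (add_le_add h.psiRII0Delta h.psiRII1Delta) h.xiIotaAbs h.xiIotaDeltaEi h.xiIotaDeltaZero (add_le_add h.xiIotaOdd h.xiIotaEvenTail) (add_le_add h.xiIotaOddDeltaEi h.xiIotaEvenTailDeltaEi) h.piR0DeltaEiEk ha.mubOverMu ha.mub ha.xiAbs ha.xiDeltaAbs (add_nonneg ha.xiEvenTail ha.xiOddTail) (add_nonneg ha.xiOddTailDelta ha.xiEvenTailDelta) (add_nonneg ha.psiRI0Delta ha.psiRI1Delta) (add_nonneg ha.psiRII0Delta ha.psiRII1Delta) ha.xiIotaAbs ha.xiIotaDeltaEi ha.xiIotaDeltaZero (add_nonneg ha.xiIotaOdd ha.xiIotaEvenTail) (add_nonneg ha.xiIotaOddDeltaEi ha.xiIotaEvenTailDeltaEi)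 ha.piR0DeltaEiEk hb.tmp2_lt_one

/-- (D.2) `c̲_Φ` (non-INCREASING) along `Inputs.Dom` between well-formed records (`1 ≤ d`). [folklore] -/
theorem cPhiLow_anti (hd : 1 ≤ d) (ha : a.WF d) (hb : b.WF d) (h : a.Dom b) :
    extraOfInputs d b 0 ≤ extraOfInputs d a 0 := by
  have F := ha.facts hd; have F' := hb.facts hd
  simp only [extraOfInputs, Matrix.cons_val]
  exact betaCPhiLow_anti_fn F.d_pos ha.mu_nonneg h.mu hb.mu_lt_one h.xiAlphaOneMinusZeroAtZero h.xiIotaAlphaIAtEi ha.xiAlphaOneMinusZeroAtZero ha.xiIotaAlphaIAtEi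

/-- (D.4) `β_{α,Φ} = max(I, II)` along `Inputs.Dom` between well-formed records. [folklore] -/
theorem betaAlphaPhi_mono (hd : 1 ≤ d) (ha : a.WF d) (hb : b.WF d) (h : a.Dom b) :
    (nobleBetaOfInputs d a).βαΦ ≤ (nobleBetaOfInputs d b).βαΦ := by
  have F := ha.facts hd
  simp only [nobleBetaOfInputs]
  exact max_le_max (betaapI_mono_fn F.d_pos ha.mu_nonneg h.mu hb.mu_lt_one h.xiAlphaOneMinusZeroAtEi h.xiIotaAlphaISumAroundEi ha.xiAlphaOneMinusZeroAtEi ha.xiIotaAlphaISumAroundEi)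
    (betaapII_mono_fn F.d_pos ha.mu_nonneg h.mu hb.mu_lt_one h.xiAlphaZeroMinusOneAtEi h.xiIotaAlphaIISumAroundZero ha.xiAlphaZeroMinusOneAtEi ha.xiIotaAlphaIISumAroundZero)

/-- (D.32) `β_Δ := −β̲_{ΔR,F}` is non-decreasing along `Inputs.Dom` between well-formed records. [folklore] -/
theorem betaDelta_mono (hd : 1 ≤ d) (ha : a.WF d) (hb : b.WF d) (h : a.Dom b) :
    (nobleBetaOfInputs d a).βΔ ≤ (nobleBetaOfInputs d b).βΔ := by
  have F := ha.facts hd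
  simp only [nobleBetaOfInputs]
  exact neg_le_neg (betaRfDeltaLower_anti_fn F.d_pos ha.mu_nonneg h.mu hb.mu_lt_one h.mubOverMu h.mub h.xiAbs h.xiOdd h.xiEven h.xiDeltaAbs h.xiOddDelta h.xiEvenDelta h.xiOddTail h.xiOddTailDelta h.xiEvenTailDelta h.psiRI1Delta h.psiRII0Delta h.xiIotaAbs h.xiIotaOdd h.xiIotaEven h.xiIotaDeltaEi h.xiIotaOddDeltaEi h.xiIotaEvenDeltaEi h.xiIotaDeltaZero h.xiIotaOddDeltaZero h.xiIotaEvenDeltaZero h.xiIotaEvenTail h.xiIotaEvenTailDeltaEi h.piR0DeltaEiEk ha.mubOverMu ha.mub ha.xiAbs ha.xiOdd ha.xiEven ha.xiDeltaAbs ha.xiOddDelta ha.xiEvenDelta ha.xiOddTail ha.xiOddTailDelta ha.xiEvenTailDelta ha.psiRI1Delta ha.psiRII0Delta ha.xiIotaAbs ha.xiIotaOdd ha.xiIotaEven ha.xiIotaDeltaEi ha.xiIotaOddDeltaEi ha.xiIotaEvenDeltaEi ha.xiIotaDeltaZero ha.xiIotaOddDeltaZero ha.xiIotaEvenDeltaZero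 ha.xiIotaEvenTail ha.xiIotaEvenTailDeltaEi ha.piR0DeltaEiEk hb.tmp2_lt_one)

/-- (D.3) `α̲_F` is non-INCREASING along `Inputs.Dom` between well-formed records, as long as it is still positive at
the larger record (on the admissible region `α̲_F > β_Δ ≥ 0`). [folklore] -/
theorem afLow_anti (hd : 1 ≤ d) (ha : a.WF d) (hb : b.WF d) (h : a.Dom b)
    (hpos : 0 < (nobleBetaOfInputs d b).αFlow) :
    (nobleBetaOfInputs d b).αFlow ≤ (nobleBetaOfInputs d a).αFlow := by
  have F := ha.facts hd
  simp only [nobleBetaOfInputs] at hpos ⊢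
  exact betaAfLow_anti_fn F.d_pos ha.mu_nonneg h.mu hb.mu_lt_one h.muMin h.psiAlphaIOneMinusZeroAroundEi h.psiAlphaIIZeroMinusOneAroundZero h.piAlpha hb.muMin_nonneg ha.muMin_lt_one ha.psiAlphaIOneMinusZeroAroundEi ha.psiAlphaIIZeroMinusOneAroundZero ha.piAlpha hpos

/-- (D.3) `ᾱ_F` (component 1 of `extraOfInputs`) is non-decreasing along `Inputs.Dom` between well-formed records
UNDER THE CAPS `b.mu ≤ 7/10` and `b.piAlphaLower ≤ 1/8` (see `betaAfUp_mono_fn`). [folklore] -/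
theorem afUp_mono (hd : 1 ≤ d) (ha : a.WF d) (_hb : b.WF d) (h : a.Dom b)
    (hcap : b.mu ≤ 7 / 10) (hP : b.piAlphaLower ≤ 1 / 8) :
    extraOfInputs d a 1 ≤ extraOfInputs d b 1 := by
  have F := ha.facts hd
  simp only [extraOfInputs, Matrix.cons_val]
  exact betaAfUp_mono_fn F.d_pos ha.mu_nonneg h.mu hcap h.psiAlphaIZeroMinusOneAroundEi
    h.psiAlphaIIOneMinusZeroAroundZero h.piAlphaLower ha.psiAlphaIZeroMinusOneAroundEi
    ha.psiAlphaIIOneMinusZeroAroundZero hP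


/-! ### Sign facts on the well-formed region (record level) -/

/-- (D.2) `c̄_Φ ≥ 1` on the well-formed region (`1 ≤ d`). [folklore] -/
theorem one_le_cPhiUp (hd : 1 ≤ d) (ha : a.WF d) :
    1 ≤ (nobleBetaOfInputs d a).cΦup := by
  have F := ha.facts hd
  simp only [nobleBetaOfInputs]
  exact one_le_betaCPhiUp_fn F.d_pos ha.mu_nonneg ha.mu_lt_one ha.xiAlphaZeroMinusOneAtZero ha.xiIotaAlphaIIAtZero

/-- (D.14) `β_{R,Φ} ≥ 0` on the well-formed region (`1 ≤ d`). [folklore] -/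
theorem betaRPhi_nonneg (hd : 1 ≤ d) (ha : a.WF d) :
    0 ≤ (nobleBetaOfInputs d a).βRΦ := by
  have F := ha.facts hd
  simp only [nobleBetaOfInputs]
  exact betaRp_nonneg_fn F.d_pos ha.mu_nonneg ha.mu_lt_one (mul_nonneg F.perc_nonneg ha.mubOverMu) (mul_nonneg F.perc_nonneg ha.mub) ha.xiAbs (add_nonneg ha.xiR0 ha.xiR1) (add_nonneg ha.xiEvenTail ha.xiOddTail) ha.xiIotaAbs (add_nonneg ha.xiIotaOdd ha.xiIotaEvenTail) ha.xiIotaRI0 ha.xiIotaRII0 F.tmp1_lt_one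

/-- (D.13) `β_{R,F} ≥ 0` on the well-formed region (`1 ≤ d`). [folklore] -/
theorem betaRF_nonneg (hd : 1 ≤ d) (ha : a.WF d) :
    0 ≤ extraOfInputs d a 2 := by
  have F := ha.facts hd
  simp only [extraOfInputs, Matrix.cons_val]
  exact betaRF_nonneg_fn F.d_pos ha.mu_nonneg ha.mu_lt_one ha.mub (mul_nonneg F.perc_nonneg ha.mubOverMu) (mul_nonneg F.perc_nonneg ha.mub) ha.xiAbs (add_nonneg ha.xiEvenTail ha.xiOddTail) ha.xiIotaAbs (add_nonneg ha.xiIotaOdd ha.xiIotaEvenTail) (add_nonneg ha.psiRI0 ha.psiRI1) (add_nonneg ha.psiRII0 ha.psiRII1) ha.piR0 F.tmp1_lt_one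

/-- (D.21) `β_{ΔR,Φ} ≥ 0` on the well-formed region (`1 ≤ d`). [folklore] -/
theorem betaRpDelta_nonneg (hd : 1 ≤ d) (ha : a.WF d) :
    0 ≤ extraOfInputs d a 3 := by
  have F := ha.facts hd
  simp only [extraOfInputs, Matrix.cons_val]
  exact betaRpDelta_nonneg_fn F.d_pos ha.mu_nonneg ha.mu_lt_one ha.mubOverMu ha.mub ha.xiAbs ha.xiDeltaAbs (add_nonneg ha.xiR0Delta ha.xiR1Delta) (add_nonneg ha.xiOddTailDelta ha.xiEvenTailDelta) ha.xiIotaAbs ha.xiIotaDeltaEi ha.xiIotaDeltaZero (add_nonneg ha.xiIotaOddDeltaEi ha.xiIotaEvenTailDeltaEi) (add_nonneg ha.xiIotaOddDeltaZero ha.xiIotaEvenTailDeltaZero) ha.xiIotaRI0DeltaEi ha.xiIotaRII0DeltaZero ha.tmp2_lt_one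

/-- (D.29) `β_{|ΔR,F|} ≥ 0` on the well-formed region (`1 ≤ d`). [folklore] -/
theorem betaRfDelta_nonneg (hd : 1 ≤ d) (ha : a.WF d) :
    0 ≤ extraOfInputs d a 4 := by
  have F := ha.facts hd
  simp only [extraOfInputs, Matrix.cons_val]
  exact betaRfDelta_nonneg_fn F.d_pos ha.mu_nonneg ha.mu_lt_one ha.mubOverMu ha.mub ha.xiAbs ha.xiDeltaAbs (add_nonneg ha.xiEvenTail ha.xiOddTail) (add_nonneg ha.xiOddTailDelta ha.xiEvenTailDelta) (add_nonneg ha.psiRI0Delta ha.psiRI1Delta) (add_nonneg ha.psiRII0Delta ha.psiRII1Delta) ha.xiIotaAbs ha.xiIotaDeltaEi ha.xiIotaDeltaZero (add_nonneg ha.xiIotaOdd ha.xiIotaEvenTail) (add_nonneg ha.xiIotaOddDeltaEi ha.xiIotaEvenTailDeltaEi) ha.piR0DeltaEiEk ha.tmp2_lt_one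

/-- (D.4) `β_{α,Φ} = max(I, II) ≥ 0` on the well-formed region. [folklore] -/
theorem betaAlphaPhi_nonneg (hd : 1 ≤ d) (ha : a.WF d) : 0 ≤ (nobleBetaOfInputs d a).βαΦ := by
  have F := ha.facts hd
  simp only [nobleBetaOfInputs]
  exact le_max_of_le_left (betaapI_nonneg_fn F.d_pos ha.mu_nonneg ha.mu_lt_one ha.xiAlphaOneMinusZeroAtEi ha.xiIotaAlphaISumAroundEi)

/-- (D.32) `β_Δ = −β̲_{ΔR,F} ≥ 0` on the well-formed region. [folklore] -/
theorem betaDelta_nonneg (hd : 1 ≤ d) (ha : a.WF d) : 0 ≤ (nobleBetaOfInputs d a).βΔ := by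
  have F := ha.facts hd
  simp only [nobleBetaOfInputs]
  exact neg_nonneg.2 (betaRfDeltaLower_nonpos_fn F.d_pos ha.mu_nonneg ha.mu_lt_one ha.mubOverMu ha.mub ha.xiAbs ha.xiOdd ha.xiEven ha.xiDeltaAbs ha.xiOddDelta ha.xiEvenDelta ha.xiOddTail ha.xiOddTailDelta ha.xiEvenTailDelta ha.psiRI1Delta ha.psiRII0Delta ha.xiIotaAbs ha.xiIotaOdd ha.xiIotaEven ha.xiIotaDeltaEi ha.xiIotaOddDeltaEi ha.xiIotaEvenDeltaEi ha.xiIotaDeltaZero ha.xiIotaOddDeltaZero ha.xiIotaEvenDeltaZero ha.xiIotaEvenTail ha.xiIotaEvenTailDeltaEi ha.piR0DeltaEiEk ha.tmp2_lt_one)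

/-! ### The box minorant of `ᾱ_F` (record level) -/

/-- `betaAfUpBox` wired to the input record (same wiring as component 1 of `extraOfInputs`). [folklore] -/
def afUpBoxOfInputs (d : ℝ) (i : Inputs) (P0 m2 : ℝ) : ℝ :=
  betaAfUpBox d i.mu i.psiAlphaIZeroMinusOneAroundEi i.psiAlphaIIOneMinusZeroAroundZero P0 m2

/-- The box minorant is below `ᾱ_F` on the box `a.mu ≤ m2 < 1`, `a.piAlphaLower ≤ P0`. [folklore] -/
theorem afUpBox_le (hd : 1 ≤ d) (ha : a.WF d) {P0 m2 : ℝ} (hm2 : a.mu ≤ m2) (hm21 : m2 < 1)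
    (hP : a.piAlphaLower ≤ P0) : afUpBoxOfInputs d a P0 m2 ≤ extraOfInputs d a 1 := by
  have F := ha.facts hd
  simp only [afUpBoxOfInputs, extraOfInputs, Matrix.cons_val]
  exact betaAfUpBox_le F.d_pos ha.mu_nonneg hm2 hm21 hP

/-- The box minorant is non-decreasing along `Inputs.Dom` between well-formed records (no cap). [folklore] -/
theorem afUpBox_mono (hd : 1 ≤ d) (ha : a.WF d) (hb : b.WF d) (h : a.Dom b) {P0 m2 : ℝ} :
    afUpBoxOfInputs d a P0 m2 ≤ afUpBoxOfInputs d b P0 m2 := by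
  have F := ha.facts hd
  simp only [afUpBoxOfInputs]
  exact betaAfUpBox_mono_fn F.d_pos ha.mu_nonneg h.mu hb.mu_lt_one h.psiAlphaIZeroMinusOneAroundEi
    h.psiAlphaIIOneMinusZeroAroundZero ha.psiAlphaIZeroMinusOneAroundEi ha.psiAlphaIIOneMinusZeroAroundZero


end Record

end BetaMap
end Literature.Probability.FitznerVanDerHofstad2017

end
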